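import Literature.MathematicalPhysics.QuantumFieldTheory.Balaban1983to89.B9Ineq3131Assembly

/-!
# `Balaban1983to89.B9Ineq3131Letters` — [Balaban1985BackgroundPropagators] p. 421–422, inequality (3.131) FROM THE LETTERS: the six
# composite inputs of `B9Ineq3131Assembly.ineq3131_assembled` (Theorem 3.1 (3.42) ∘ (3.49) for print's `𝒫 = G′(U)R(U)D*_U`, sup and L¹
# readings, on the cubes and their unit translates) DERIVED from (3.42)-shaped letters for `G′(U)`, (3.49)-shaped letters for `P(U)`
# (`R = I − P`), the η-divergence `D^{η*}_U` of (3.8) and [4] Lemma 2.1 — FILE 67 of the Sect. A–D programme of cell `lit-balaban`,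
# seat r06 (B9 fold owner) gen 24; row B9.Eq3.130 (= (3.130)–(3.131))

statement-level skeleton of published theorems with citation tags; proofs where landed; nothing here is a claim about the Yang–Mills mass gap

DOCFIX v1.2 (seat r06 gen 26, 2026-08-24; referee ref-4 g72 note D-g72-2, zero weight): the two guillemet phrases «insert Σ_{y″}Δ(y″) = I» (this
header, §1 `piece_apply_of_eq`, §3 `sup_of_near`) and «operators … given by kernels» (§7 `majorant_of_kernel`) were this seat's paraphrases of [4] (2.52)
and of the kernel reading of (3.42), not print sentences; they are now marked as ours (no guillemets). Declarations, statements and proofs are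
byte-identical to the tree copy of record (p366939 + v1.1 p367415, sha16 02114bb6754810fc).

CITATION HEADER (lean-in-tree rule).  B9 = T. Bałaban, *Propagators for lattice gauge theories in a background field*, Commun. Math. Phys.
**99** (1985) 389–434 [Balaban1985BackgroundPropagators] (held `paper:balaban1985-cmp99-background-propagators`, journal page = PDF page + 388;
renders `b2b-balaban-ref1/pages/1985-cmp99-background-propagators/…-p009-x2.png`, `…-p033-x2.png`, `…-p034-x2.png` RE-READ AS IMAGES by this
seat 2026-08-23).  p. 421 [PDF 33]: «Let us denote for a moment the operator we have investigated in previous sections by G₀, i.e. G₀ = (Δ + DRD* +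
Q*aQ)⁻¹. From (3.120) we get G = G₀(I − Δ′_πG₀)⁻¹ = Σ_{n=0}^∞ G₀(Δ′_πG₀)ⁿ. (3.130) It is easy to find estimates for the operator Δ′_π, using
Theorem 3.1 and the inequality (3.49), we have to be careful only with the third term in the definition (3.120) of Δ′_π. One of the three
derivatives there has to be applied either to an expression on the right, or on the left, of Δ′_π. For example one of the terms in ⟨A₁,Δ′_πA₂⟩ is
½⟨i[(DG′RD*A₁)(b), (G′RD*A₂)(b₋)], J⟩,» p. 422 [PDF 34]: «and we apply the derivative D* to A₁. We have |⟨A₁Δ′_πA₂⟩| ≦ O(1)Mα₀(‖D*A₁‖_{L¹} +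
(Lʲη)^{−1}‖A₁‖_{L¹})e^{−(1/2)δ₀d(y,y′)}(|D*A₂| + (L^{j′}η)^{−1}|A₂|) for supp A₁ ⊂ Δ(y), y ∈ Λ_j, supp A₂ ⊂ Δ(y′), y′ ∈ Λ_{j′}. (3.131)».  The
inputs print names, as printed: Theorem 3.1 (3.42) p. 397 [PDF 9] «|(G′(U)λ)(x)|, |(∇_UG′(U)λ)(x)|, |(G′(U)∇*_Uλ)(x)|, |(Δ_UG′(U)λ)(x)| ≦ B₀[(Lʲη)²,
Lʲη, Lʲη, 1]e^{−δ₀d(y,y′)}|λ| for x ∈ Δ(y), y ∈ Λ_j, supp λ ⊂ Δ(y′)»; p. 397 «Let us recall that if y ∈ Λ_j, then Δ(y) = Bʲ(y), and Δ̃(y) is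
a cube of the size 2Lʲη on the lattice T_η with center at the point y»; (3.49) p. 399 «For the operator P = I − R we obtain, using again Lemma 2.1,
[|P(x,x′)|, |(DP)_μ(x,x′)|, |(PD*)_ν(x,x′)|, |(DPD*)_{μν}(x,x′)|] ≦ O(1)[1, (Lʲη)^{−1}, (Lʲη)^{−1}, (Lʲη)^{−2}](L^{j′}η)^{−d}e^{−(1/2)δ₀d(y,y′)} for
x ∈ Δ(y), y ∈ Λ_j, x′ ∈ Δ(y′), y′ ∈ Λ_{j′}»; p. 394 (R of (3.21)/(3.25) the orthogonal projection, P = I − R, hence P symmetric); (3.8) p. 392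
(the divergence D^{η*}_U); p. 398 «Using Lemma 2.1 in [4] we may replace the factor (Lʲη)^α by (Lʲη)^β(L^{j′}η)^γ with β + γ = α».  [4] =
[Balaban1984PropagatorsII] T. Bałaban, *Propagators and renormalization transformations for lattice gauge theories. II*, Commun. Math. Phys.
**96** (1984) 223–250: (2.2) p. 224 (neighbouring cubes of the partition differ by at most one level), (2.52)–(2.55) p. 232–233 (the block
decomposition (2.52) — «insert Σ_{y″}Δ(y″) = I» is this seat's paraphrase, not print — and the triangle inequality (2.54)), Lemma 2.1 (2.60)–(2.61) p. 234.

WHAT THIS FILE PROVES (theorems only: 0 `def`, 0 named fact, 0 sorry, standard axioms; the block pieces `Δ(y)λ` of [4] (2.52) are Mathlib's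
`Set.indicator (blk ⁻¹' {y}) λ`).  Setting = `B9Ineq3131Assembly` §3 verbatim: the exact-background lattice `(S, ι, T, U)` of
`B9Eq39Adjoint` (𝔸-valued site/bond functions, `R(U)X = UXU⁻¹`), a block map `blk : S → 𝔅` into the coarse sites of a `B6.Geometry` (`blk x = y
⟺ x ∈ Δ(y)`), the printed norms `ssup`/`sl1`/`sl1On`/`bl1On` of (3.39)/(3.131), `D^η_U = covDη`, `D^{η*}_U = divBη`.  The letters are ADDITIVE
maps `G′, P : (S → 𝔸) →+ (S → 𝔸)` (print: linear operators; only additivity is used) with hypotheses of the PRINTED SHAPES: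
(G) Theorem 3.1 (3.42)₁,₂ for `G′(U)` as block majorants — `|(G′λ)(x)| ≦ B_G(Lʲη)²e^{−δ₀d(y,y″)}B`, `|(D^η_UG′λ)_μ(x)| ≦ B_G(Lʲη)e^{−δ₀d(y,y″)}B`
for `x ∈ Δ(y)`, `supp λ ⊂ Δ(y″)`, `|λ| ≦ B` (`hG0`, `hG1`) — and the L¹ DUALS of (3.42)₁,₃ for the symmetric `G′` — `‖G′λ‖_{L¹(Δ(y″))} ≦
B_G(Lʲη)²e^{−δ₀d(y,y″)}‖λ‖_{L¹}`, `‖D^η_UG′λ‖_{L¹(Δ(y″))} ≦ B_G(Lʲη)e^{−δ₀d(y,y″)}‖λ‖_{L¹}` for `supp λ ⊂ Δ(y)` (`hG0d`, `hG1d`; the reading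
already fixed in `B9Ineq3131Assembly` (iv));
(P) (3.49)₁ for `P(U)` in the printed pointwise-kernel form after the triangle inequality — `|(Pλ)(z)| ≦ Σ_{x′} η^d·K_Pe^{−δ₁d(y_z,y_{x′})}v(y_{x′})⁻¹·|λ(x′)|`
(column-volume reading, `v(y′) = (L^{j′}η)^d` the block volume, `η^d#Δ(y′) ≦ v(y′)`: `hP`, `hvol`) and the same with `v(y_z)⁻¹` (row-volume
reading = (3.49)₁ for the adjoint kernel = (3.49)₁ by the symmetry of `P`: `hPt`), at a rate `δ₁` (printed: `½δ₀`);
(Δ̃) the block-map geometry of the unit translates: `d(y_x, y_{x+e_μ}) ≦ r₀`, `L^{j(x+e_μ)}η ≦ Λ_T·L^{j(x)}η` (`hnb`, `hnbl`; print: the translates of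
Δ(y) lie in Δ̃(y), neighbouring cubes differ by at most one level — `Λ_T = L`, `r₀ = O(1)`);
([4]) `d ≧ 0` symmetric with `d(y,y) = 0` and (2.54); the row sum (2.61) at rate `σ` with constant `c`; (2.60) at rate `αδ₀` with `2 log L ≦ αδ₀RM`.
* §1 block pieces (`sum_piece`: Σ_yΔ(y)λ = λ) and the block-wise bookkeeping of the (3.131) norms (`sl1_eq_sum_sl1On`, subadditivity of `sl1On`/`bl1On`).
* §2 rate plumbing ([4] (2.54)): `count_near_le` (`#{b : d(b,y′) ≦ r₀} ≦ ce^{σr₀}` from (2.61)); `covDη_sub`/`covDη_sum`; **`divBη_eq_zero_of_far`**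
  (supp D*A ⊂ Δ(y) ∪ ⋃_μ(Δ(y) + e_μ) for supp A ⊂ Δ(y), from (3.8)).
* §3 the two generic compositions behind «using Theorem 3.1 and the inequality (3.49)»: **`sup_of_near`** (a (3.42)-majorant letter on a function
  supported in cubes within `r₀` of Δ(y′): the block decomposition (2.52) (paraphrase ours: insert Σ_{y″}Δ(y″) = I) + (2.54)), **`sup_of_spread`** (the same letter on a spread function with
  near sources, the convolution (2.54) + (2.61) — `B11SectG.conv_exp_le` — at `δ₁ + σ ≦ δ₀`).
* §4 the (3.49) letter on a function supported near a cube: **`norm_P_le_near`** (sup reading, volume factor `η^d#Δ(b)·v(b)⁻¹ ≦ 1`),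
  **`sl1On_P_le_near`** (L¹ reading).
* §5 **`sup_entry`** (generic) and the three SUP inputs for `λ` supported within `r₀` of Δ(y′): **`sup_entry0`** `|(G′(λ − Pλ))(x)| ≦
  C_S(Lʲη)²e^{−δ₁d(y,y′)}|λ|`, **`sup_entry0_shift`** (at `x + e_μ`, factor `Λ_T²e^{δ₁r₀}`), **`sup_entry1`** `|(D^η_UG′(λ − Pλ))_μ(x)| ≦
  C_S(Lʲη)e^{−δ₁d(y,y′)}|λ|`, `C_S = ce^{σr₀}(e^{δ₀r₀} + cK_Pe^{δ₁r₀})B_G`.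
* §6 **`l1_entry`** (generic, with the p. 398 transfer (2.60) = `B9SectDL2Decay.len_pow_le_of_ineq260` for the far cubes of the spread function)
  and the three L¹ inputs for `λ` supported within `r₀` of Δ(y) in cubes of size `≦ Λ_TLʲη`: **`l1_entry0`** `‖G′(λ − Pλ)‖_{L¹(Δ(y″))} ≦
  C_L(Lʲη)²e^{−(δ₁−αδ₀)d(y,y″)}‖λ‖_{L¹}`, **`l1_entry0_shift`** (translates, via `sl1On_comp_perm_le` + `sum_near_le`), **`l1_entry1`**
  (`D^η_UG′`, power 1), `C_L = B_G(Λ_T²e^{δ₀r₀} + L²cK_Pe^{δ₁r₀})`.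
* §7 **`divBη_support`** (for supp A ⊂ Δ(y): supp D*A within `r₀` of Δ(y) in cubes of size ≦ Λ_TLʲη) and **`ineq3131_letters`** = (3.131) FOR
  PRINT'S `𝒫A = G′(D*A − PD*A) = G′RD*A`: `B9Ineq3131Assembly.ineq3131_assembled` with its six composite hypotheses DISCHARGED by §§5–6, at
  `δ_P = δ₁ − αδ₀`, the printed norms `‖D*A₁‖_{L¹}`, `|D*A₂|`, `|A₂|`, every `ρ ≧ 0` with `ρ + σ + αδ₀ ≦ δ₁ − αδ₀`, and the EXPLICIT `C_P` = the sum
  of the six entry constants; **`ineq3131_letters_printedRate`** = the instance `δ₁ = ½δ₀` (the printed rate of (3.49)): (3.131) at every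
  `ρ ≧ 0` with `ρ + σ + 2αδ₀ ≦ ½δ₀`.
Remaining hypotheses of `ineq3131_letters`, each the object of another row: `hJ` = (3.36) in the form used on p. 422 (PROVED for regular
backgrounds: `B9Eq336CurrentBound`, row B9.Eq3.35; `B9Ineq3131Regular`), the (3.42)/(3.49) letters (rows B9.Thm3.1 / B9.Eq3.49 — for print's own
`P(U) = G′Q′*(Q′G′²Q′*)⁻¹Q′G′` the (3.49) kernel bounds are themselves derived from Theorems 3.1/3.2 in `B9Ineq349KernelU`, real-coordinate typing),
[4] Lemma 2.1 (row B6 Lemma 2.1, `B6RandomWalk.Ineq260`/`B11SectG.RowSum`).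

HONEST SCOPE / NOT CLAIMED.  (i) Theorem 3.1 and (3.49) are INPUTS (letters); the file certifies print's «using Theorem 3.1 and the inequality
(3.49)» step from the letters to (3.131), for print's own composite `G′RD*`, nothing more.  (ii) The L¹ entries use the DUAL (transposed)
readings of (3.42)₁,₃ and (3.49)₁, which print obtains from the symmetry of `G′ = (Δ′_a)⁻¹` and of `P` (p. 394); here they are hypotheses of
the dual shape, not derived from a symmetry hypothesis.  (iii) Rates (cell GAPS G-B9-r06-2, DIVERGENCE D-r1.2): with (3.49) at its printed rate
`½δ₀` the six inputs hold at `δ_P = ½δ₀ − αδ₀` and (3.131) at `ρ = ½δ₀ − 2αδ₀ − σ` for every admissible `α, σ` of [4] Lemma 2.1 — print's `½δ₀` in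
(3.131) is its generic-constant convention («O(1), δ₀» re-defined as common best constants, pp. 423–424); no rate is asserted beyond this.  (iv)
The cubes Δ̃(y) are modelled by the two block-map hypotheses (Δ̃) (distance ≦ r₀, size ratio ≦ Λ_T) — the (2.2) geometry of [4] is not
re-derived; `C_P` depends on `B_G, K_P, c, σ, r₀, δ₀, δ₁, α, L, Λ_T` only («O(1)»).  (v) `G′`, `P` additive maps on 𝔸-valued site functions with
norm bounds (print: real-linear operators on 𝔤-valued functions); the convergence sentence after (3.131) (Theorem 3.3 for G via (3.130)) is rows
B9.Thm3.3/B9.Thm3.12's (`B9SectDSup`, `B9SectDL2Decay`, `B9SectDForm`), not treated here.  NOT summit progress.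

v1.1 (r06 g24, APPEND-ONLY over v1 p366939 ✓713800a4255c; every v1 declaration byte-identical): §8 `majorant_of_kernel`, `bmajorant_of_kernel`,
`dual_of_kernelT`, `bdual_of_kernelT` — the (3.42)-majorant and L¹-dual letter shapes of `ineq3131_letters` DERIVED from kernel-sum bounds in the
printed kernel form of p. 393 (column-volume reading ⇒ majorant; row-volume reading = the bound for the adjoint kernel ⇒ L¹ dual), and
**`ineq3131_kernelLetters`** = (3.131) with ALL letters (Theorem 3.1 for `G′`, `∇_UG′`; (3.49) for `P`) as kernel-sum bounds in both volume readings
(HONEST SCOPE (ii) thereby reduced to: the row-volume readings are (3.42)/(3.49) for the adjoint kernels, = the printed bounds by the symmetry of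
`G′`, `∇_UG′ ↔ G′∇*_U`, `P` — symmetry itself not formalised), constant `B_G(1 + |ι|)`.

RELATED IN THE TREE, NOT DUPLICATED (searched 2026-08-23: `lean search --decl 'ineq3131'` = `B9Ineq3131Assembly.ineq3131_assembled`/`_printed`,
`B9Ineq3131Regular.ineq3131_of_regular`/`_printed_of_regular` only — all with the six composites as HYPOTHESES; `lean search --decl
'sup_of_near|l1_entry|sup_entry|divBη_support|count_near_le'` = ∅): the ℝ-coordinate kernel calculus of `B6RandomWalk`/`B6RandomWalkKernel`/
`B9Ineq385Kernel`/`B9Ineq349KernelU` (`HasMajorant`, `HasKernelBound`, `conj b`) composes WORDS of letters as majorants/kernels; here the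
composites are taken directly in the 𝔸-valued norms of `B9Ineq3131Assembly`, whose hypotheses they discharge.  Imports `B9Ineq3131Assembly` only.
-/

noncomputable section

namespace Literature.MathematicalPhysics.QuantumFieldTheory.Balaban1983to89.B9Ineq3131Letters

open Literature.MathematicalPhysics.QuantumFieldTheory.Balaban1983to89
open Literature.MathematicalPhysics.QuantumFieldTheory.Balaban1983to89.B9Eq39Adjoint (R divB covDstar covD R_def)
open Literature.MathematicalPhysics.QuantumFieldTheory.Balaban1983to89.B9Eq3117Current (covDη)
open Literature.MathematicalPhysics.QuantumFieldTheory.Balaban1983to89.B9Ineq3131Assembly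
open Literature.MathematicalPhysics.QuantumFieldTheory.Balaban1983to89.B6RandomWalk (Triangle254 Ineq260)
open Literature.MathematicalPhysics.QuantumFieldTheory.Balaban1983to89.B11SectG (RowSum conv_exp_le)
open Literature.MathematicalPhysics.QuantumFieldTheory.Balaban1983to89.B9SectDSup (DistSymm colSum_of_rowSum)
open Literature.MathematicalPhysics.QuantumFieldTheory.Balaban1983to89.B9SectCDiffFrame (len_pos)

/-! ## §1 Block pieces of a site function and the block-wise bookkeeping of the norms (3.39)/(3.131) -/

section Pieces

variable {𝔸 : Type*} [NormedRing 𝔸]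
variable {S : Type*} {Y : Type*} (blk : S → Y)

/-- On its own cube the block piece `Δ(y)λ = 𝟙_{Δ(y)}λ` (Mathlib's `Set.indicator (blk ⁻¹' {y}) λ`; [4] (2.52) — paraphrase
ours: insert Σ_{y″}Δ(y″) = I) is the function. [cite: Balaban1984PropagatorsII, (2.52) p.232] -/
theorem piece_apply_of_eq {y : Y} (f : S → 𝔸) {x : S} (h : blk x = y) : Set.indicator (blk ⁻¹' {y}) f x = f x :=
  Set.indicator_of_mem (show x ∈ blk ⁻¹' {y} from h) f

/-- Off its cube the block piece vanishes. [cite: Balaban1984PropagatorsII, (2.52) p.232] -/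
theorem piece_apply_of_ne {y : Y} (f : S → 𝔸) {x : S} (h : blk x ≠ y) : Set.indicator (blk ⁻¹' {y}) f x = 0 :=
  Set.indicator_of_notMem (show x ∉ blk ⁻¹' {y} from h) f

/-- `|Δ(y)λ(x)| ≦ |λ(x)|`. [cite: Balaban1984PropagatorsII, (2.52) p.232] -/
theorem norm_piece_le (y : Y) (f : S → 𝔸) (x : S) : ‖Set.indicator (blk ⁻¹' {y}) f x‖ ≤ ‖f x‖ := by
  by_cases h : blk x = y
  · rw [piece_apply_of_eq blk f h]
  · rw [piece_apply_of_ne blk f h, norm_zero]; exact norm_nonneg _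

/-- **`Σ_{y∈𝔅} Δ(y)λ = λ`** (the cubes partition the lattice). [cite: Balaban1984PropagatorsII, (2.52) p.232 + (2.4) p.224] -/
theorem sum_piece [Fintype Y] (f : S → 𝔸) : ∑ y, Set.indicator (blk ⁻¹' {y}) f = f := by
  classical
  funext x
  rw [Finset.sum_apply, Finset.sum_eq_single (blk x) (fun b _ hb => piece_apply_of_ne blk f (Ne.symm hb))
    (fun h => absurd (Finset.mem_univ _) h)]
  exact piece_apply_of_eq blk f rfl

/-- The piece of a cube containing no point of the support is zero. [cite: Balaban1984PropagatorsII, (2.52) p.232] -/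
theorem piece_eq_zero {y : Y} {f : S → 𝔸} (h : ∀ x, blk x = y → f x = 0) : Set.indicator (blk ⁻¹' {y}) f = 0 := by
  funext x
  by_cases hx : blk x = y
  · rw [piece_apply_of_eq blk f hx, h x hx]; rfl
  · rw [piece_apply_of_ne blk f hx]; rfl

variable [Fintype S]

open Classical in
/-- A lattice sum organised cube by cube: `Σ_x G(x) = Σ_{y∈𝔅} Σ_{x∈Δ(y)} G(x)`. [cite: Balaban1984PropagatorsII, (2.52) p.232] -/
theorem sum_eq_sum_blocks [Fintype Y] (G : S → ℝ) : ∑ x, G x = ∑ y, ∑ x, (if blk x = y then G x else 0) := by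
  have h := sum_mul_eq_sum_fiber blk (fun _ : Y => (1 : ℝ)) G
  simpa only [one_mul] using h

open Classical in
/-- `‖Δ(y)λ‖_{L¹} = ‖λ‖_{L¹(Δ(y))}`: the L¹ norm of a piece is the block part of the L¹ norm.
[cite: Balaban1985BackgroundPropagators, (3.131) p.422] -/
theorem sl1_piece (η : ℝ) (d : ℕ) (y : Y) (f : S → 𝔸) : sl1 η d (Set.indicator (blk ⁻¹' {y}) f) = sl1On blk η d y f := by
  rw [sl1, sl1On_def]
  congr 1
  refine Finset.sum_congr rfl fun x _ => ?_
  by_cases h : blk x = y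
  · rw [piece_apply_of_eq blk f h, if_pos h]
  · rw [piece_apply_of_ne blk f h, if_neg h, norm_zero]

/-- **`‖λ‖_{L¹} = Σ_{y∈𝔅} ‖λ‖_{L¹(Δ(y))}`**. [cite: Balaban1985BackgroundPropagators, (3.131) p.422; Balaban1984PropagatorsII, (2.52) p.232] -/
theorem sl1_eq_sum_sl1On [Fintype Y] (η : ℝ) (d : ℕ) (f : S → 𝔸) : sl1 η d f = ∑ y, sl1On blk η d y f := by
  classical
  rw [sl1, sum_eq_sum_blocks blk (fun x => ‖f x‖), Finset.mul_sum]
  refine Finset.sum_congr rfl fun y _ => ?_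
  rw [sl1On_def]

/-- `0 ≦ ‖λ‖_{L¹(Δ(y))}` for `η ≧ 0`. [cite: Balaban1985BackgroundPropagators, (3.131) p.422] -/
theorem sl1On_nonneg {η : ℝ} (hη : 0 ≤ η) (d : ℕ) (y : Y) (f : S → 𝔸) : 0 ≤ sl1On blk η d y f := by
  classical
  rw [sl1On_def]
  exact mul_nonneg (pow_nonneg hη d) (Finset.sum_nonneg fun x _ => by split_ifs <;> simp)

/-- `0 ≦ ‖A‖_{L¹(Δ(y))}` for `η ≧ 0`. [cite: Balaban1985BackgroundPropagators, (3.131) p.422] -/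
theorem bl1On_nonneg {ι : Type*} [Fintype ι] {η : ℝ} (hη : 0 ≤ η) (d : ℕ) (y : Y) (A : ι → S → 𝔸) :
    0 ≤ bl1On blk η d y A := by
  classical
  rw [bl1On_def]
  exact mul_nonneg (pow_nonneg hη d)
    (Finset.sum_nonneg fun x _ => by split_ifs <;> simp [Finset.sum_nonneg, norm_nonneg])

/-- Monotonicity of the block L¹ norm under a pointwise norm comparison. [cite: Balaban1985BackgroundPropagators, (3.131) p.422] -/
theorem sl1On_mono {η : ℝ} (hη : 0 ≤ η) (d : ℕ) (y : Y) {f h : S → 𝔸} (hle : ∀ x, blk x = y → ‖f x‖ ≤ ‖h x‖) :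
    sl1On blk η d y f ≤ sl1On blk η d y h := by
  classical
  rw [sl1On_def, sl1On_def]
  refine mul_le_mul_of_nonneg_left (Finset.sum_le_sum fun x _ => ?_) (pow_nonneg hη d)
  by_cases hx : blk x = y
  · rw [if_pos hx, if_pos hx]; exact hle x hx
  · rw [if_neg hx, if_neg hx]

/-- Subadditivity of the block L¹ norm. [cite: Balaban1985BackgroundPropagators, (3.131) p.422] -/
theorem sl1On_add_le {η : ℝ} (hη : 0 ≤ η) (d : ℕ) (y : Y) (f h : S → 𝔸) :
    sl1On blk η d y (f + h) ≤ sl1On blk η d y f + sl1On blk η d y h := by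
  classical
  rw [sl1On_def, sl1On_def, sl1On_def, ← mul_add, ← Finset.sum_add_distrib]
  refine mul_le_mul_of_nonneg_left (Finset.sum_le_sum fun x _ => ?_) (pow_nonneg hη d)
  by_cases hx : blk x = y
  · rw [if_pos hx, if_pos hx, if_pos hx, Pi.add_apply]; exact norm_add_le _ _
  · rw [if_neg hx, if_neg hx, if_neg hx, add_zero]

/-- Subadditivity of the block L¹ norm, differences. [cite: Balaban1985BackgroundPropagators, (3.131) p.422] -/
theorem sl1On_sub_le {η : ℝ} (hη : 0 ≤ η) (d : ℕ) (y : Y) (f h : S → 𝔸) :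
    sl1On blk η d y (f - h) ≤ sl1On blk η d y f + sl1On blk η d y h := by
  classical
  rw [sl1On_def, sl1On_def, sl1On_def, ← mul_add, ← Finset.sum_add_distrib]
  refine mul_le_mul_of_nonneg_left (Finset.sum_le_sum fun x _ => ?_) (pow_nonneg hη d)
  by_cases hx : blk x = y
  · rw [if_pos hx, if_pos hx, if_pos hx, Pi.sub_apply]; exact norm_sub_le _ _
  · rw [if_neg hx, if_neg hx, if_neg hx, add_zero]

/-- Subadditivity of the block L¹ norm over a finite sum. [cite: Balaban1985BackgroundPropagators, (3.131) p.422] -/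
theorem sl1On_sum_le {η : ℝ} (hη : 0 ≤ η) (d : ℕ) (y : Y) {W : Type*} (s : Finset W) (F : W → S → 𝔸) :
    sl1On blk η d y (∑ w ∈ s, F w) ≤ ∑ w ∈ s, sl1On blk η d y (F w) := by
  classical
  induction s using Finset.induction_on with
  | empty =>
    rw [Finset.sum_empty, Finset.sum_empty, sl1On_def]
    simp
  | insert w s hw ih =>
    rw [Finset.sum_insert hw, Finset.sum_insert hw]
    exact (sl1On_add_le blk hη d y _ _).trans (by linarith)

/-- Subadditivity of the bond block L¹ norm, differences. [cite: Balaban1985BackgroundPropagators, (3.131) p.422] -/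
theorem bl1On_sub_le {ι : Type*} [Fintype ι] {η : ℝ} (hη : 0 ≤ η) (d : ℕ) (y : Y) (A B : ι → S → 𝔸) :
    bl1On blk η d y (A - B) ≤ bl1On blk η d y A + bl1On blk η d y B := by
  classical
  rw [bl1On_def, bl1On_def, bl1On_def, ← mul_add, ← Finset.sum_add_distrib]
  refine mul_le_mul_of_nonneg_left (Finset.sum_le_sum fun x _ => ?_) (pow_nonneg hη d)
  by_cases hx : blk x = y
  · rw [if_pos hx, if_pos hx, if_pos hx, ← Finset.sum_add_distrib]
    exact Finset.sum_le_sum fun μ _ => by rw [Pi.sub_apply, Pi.sub_apply]; exact norm_sub_le _ _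
  · rw [if_neg hx, if_neg hx, if_neg hx, add_zero]

/-- Subadditivity of the bond block L¹ norm. [cite: Balaban1985BackgroundPropagators, (3.131) p.422] -/
theorem bl1On_add_le {ι : Type*} [Fintype ι] {η : ℝ} (hη : 0 ≤ η) (d : ℕ) (y : Y) (A B : ι → S → 𝔸) :
    bl1On blk η d y (A + B) ≤ bl1On blk η d y A + bl1On blk η d y B := by
  classical
  rw [bl1On_def, bl1On_def, bl1On_def, ← mul_add, ← Finset.sum_add_distrib]
  refine mul_le_mul_of_nonneg_left (Finset.sum_le_sum fun x _ => ?_) (pow_nonneg hη d)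
  by_cases hx : blk x = y
  · rw [if_pos hx, if_pos hx, if_pos hx, ← Finset.sum_add_distrib]
    exact Finset.sum_le_sum fun μ _ => by rw [Pi.add_apply, Pi.add_apply]; exact norm_add_le _ _
  · rw [if_neg hx, if_neg hx, if_neg hx, add_zero]

/-- Subadditivity of the bond block L¹ norm over a finite sum. [cite: Balaban1985BackgroundPropagators, (3.131) p.422] -/
theorem bl1On_sum_le {ι : Type*} [Fintype ι] {η : ℝ} (hη : 0 ≤ η) (d : ℕ) (y : Y) {W : Type*} (s : Finset W)
    (F : W → ι → S → 𝔸) : bl1On blk η d y (∑ w ∈ s, F w) ≤ ∑ w ∈ s, bl1On blk η d y (F w) := by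
  classical
  induction s using Finset.induction_on with
  | empty =>
    rw [Finset.sum_empty, Finset.sum_empty, bl1On_def]
    simp
  | insert w s hw ih =>
    rw [Finset.sum_insert hw, Finset.sum_insert hw]
    exact (bl1On_add_le blk hη d y _ _).trans (by linarith)

/-- Monotonicity of the bond block L¹ norm under a pointwise comparison. [cite: Balaban1985BackgroundPropagators, (3.131) p.422] -/
theorem bl1On_mono {ι : Type*} [Fintype ι] {η : ℝ} (hη : 0 ≤ η) (d : ℕ) (y : Y) {A B : ι → S → 𝔸}
    (hle : ∀ μ x, blk x = y → ‖A μ x‖ ≤ ‖B μ x‖) : bl1On blk η d y A ≤ bl1On blk η d y B := by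
  classical
  rw [bl1On_def, bl1On_def]
  refine mul_le_mul_of_nonneg_left (Finset.sum_le_sum fun x _ => ?_) (pow_nonneg hη d)
  by_cases hx : blk x = y
  · rw [if_pos hx, if_pos hx]; exact Finset.sum_le_sum fun μ _ => hle μ x hx
  · rw [if_neg hx, if_neg hx]

open Classical in
/-- The block L¹ norm is the part of the L¹ norm on the cube: `‖λ‖_{L¹(Δ(y))} ≦ ‖λ‖_{L¹}` (`η ≧ 0`).
[cite: Balaban1985BackgroundPropagators, (3.131) p.422] -/
theorem sl1On_le_sl1 [Fintype Y] {η : ℝ} (hη : 0 ≤ η) (d : ℕ) (y : Y) (f : S → 𝔸) : sl1On blk η d y f ≤ sl1 η d f := by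
  rw [sl1_eq_sum_sl1On blk η d f]
  exact Finset.single_le_sum (f := fun y' => sl1On blk η d y' f) (fun y' _ => sl1On_nonneg blk hη d y' f) (Finset.mem_univ y)

end Pieces


/-! ## §2 Elementary geometry of the rates ([4] (2.54), Lemma 2.1 (2.61)) and the `η`-divergence bookkeeping -/

section Rates

variable {g : B6.Geometry}

/-- Rates only improve: `e^{−δt} ≦ e^{−δ′t}` for `δ′ ≦ δ`, `t ≧ 0` (arithmetic plumbing). [folklore] -/
private theorem exp_rate_le {δ' δ t : ℝ} (hδ : δ' ≤ δ) (ht : 0 ≤ t) : Real.exp (-(δ * t)) ≤ Real.exp (-(δ' * t)) :=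
  Real.exp_le_exp.mpr (by nlinarith)

/-- **Moving the source of a decay factor by a bounded distance** ([4] (2.54)): if `d(b, y′) ≦ r₀` then
`e^{−δd(a,b)} ≦ e^{δr₀}·e^{−δd(a,y′)}` (`δ ≧ 0`; arithmetic plumbing). [cite: Balaban1984PropagatorsII, (2.54) p.233] -/
private theorem exp_near (htri : Triangle254 g) {δ r₀ : ℝ} (hδ : 0 ≤ δ) {a b y' : g.Site} (hnear : g.dist b y' ≤ r₀) :
    Real.exp (-(δ * g.dist a b)) ≤ Real.exp (δ * r₀) * Real.exp (-(δ * g.dist a y')) := by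
  rw [← Real.exp_add]
  refine Real.exp_le_exp.mpr ?_
  have h := htri a b y'
  nlinarith

/-- The same with the bounded distance on the left: if `d(y, b) ≦ r₀` then `e^{−δd(b,a)} ≦ e^{δr₀}·e^{−δd(y,a)}` (`δ ≧ 0`).
[cite: Balaban1984PropagatorsII, (2.54) p.233] -/
private theorem exp_near' (htri : Triangle254 g) {δ r₀ : ℝ} (hδ : 0 ≤ δ) {a b y : g.Site} (hnear : g.dist y b ≤ r₀) :
    Real.exp (-(δ * g.dist b a)) ≤ Real.exp (δ * r₀) * Real.exp (-(δ * g.dist y a)) := by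
  rw [← Real.exp_add]
  refine Real.exp_le_exp.mpr ?_
  have h := htri y b a
  nlinarith

open Classical in
/-- **The number of cubes within distance `r₀` of a cube is `O(1)`**: `#{b : d(b,y′) ≦ r₀} ≦ c·e^{σr₀}` from the row sum (2.61) at
rate `σ ≧ 0` and the symmetry of `d`. [cite: Balaban1984PropagatorsII, Lemma 2.1 (2.61) p.234] -/
theorem count_near_le (hsym : DistSymm g) {σ c : ℝ} (hrow : RowSum g σ c) (hσ : 0 ≤ σ) (r₀ : ℝ) (y' : g.Site) :
    ∑ b : g.Site, (if g.dist b y' ≤ r₀ then (1 : ℝ) else 0) ≤ c * Real.exp (σ * r₀) := by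
  have hcol := colSum_of_rowSum hsym hrow y'
  have hterm : ∀ b : g.Site, (if g.dist b y' ≤ r₀ then (1 : ℝ) else 0) ≤
      Real.exp (σ * r₀) * Real.exp (-(σ * g.dist b y')) := by
    intro b
    split_ifs with h
    · rw [← Real.exp_add]
      exact Real.one_le_exp (by nlinarith)
    · exact mul_nonneg (Real.exp_nonneg _) (Real.exp_nonneg _)
  calc ∑ b : g.Site, (if g.dist b y' ≤ r₀ then (1 : ℝ) else 0)
      ≤ ∑ b : g.Site, Real.exp (σ * r₀) * Real.exp (-(σ * g.dist b y')) := Finset.sum_le_sum fun b _ => hterm b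
    _ = Real.exp (σ * r₀) * ∑ b : g.Site, Real.exp (-(σ * g.dist b y')) := by rw [Finset.mul_sum]
    _ ≤ Real.exp (σ * r₀) * c := mul_le_mul_of_nonneg_left hcol (Real.exp_nonneg _)
    _ = c * Real.exp (σ * r₀) := mul_comm _ _

end Rates

section Divergence

variable {𝔸 : Type*} [NormedRing 𝔸] [NormedAlgebra ℂ 𝔸]
variable {S : Type*} {ι : Type*}
variable (T : ι → Equiv.Perm S) (U : ι → S → 𝔸ˣ)

/-- `D^η(λ₁ − λ₂) = D^ηλ₁ − D^ηλ₂`. [cite: Balaban1985BackgroundPropagators, (3.3) p.391] -/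
theorem covDη_sub (η : ℝ) (f h : S → 𝔸) (μ : ι) (x : S) :
    covDη T U η (f - h) μ x = covDη T U η f μ x - covDη T U η h μ x := by
  rw [B9Eq3117Current.covDη_apply, B9Eq3117Current.covDη_apply, B9Eq3117Current.covDη_apply,
    B9Eq39Adjoint.covD_sub, smul_sub]

/-- `D^η(Σ_w λ_w) = Σ_w D^ηλ_w`. [cite: Balaban1985BackgroundPropagators, (3.3) p.391] -/
theorem covDη_sum (η : ℝ) {W : Type*} (s : Finset W) (F : W → S → 𝔸) (μ : ι) (x : S) :
    covDη T U η (∑ w ∈ s, F w) μ x = ∑ w ∈ s, covDη T U η (F w) μ x := by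
  classical
  induction s using Finset.induction_on with
  | empty =>
    rw [Finset.sum_empty, Finset.sum_empty, B9Eq3117Current.covDη_apply, B9Eq39Adjoint.covD_zero, smul_zero]
  | insert w s hw ih =>
    rw [Finset.sum_insert hw, Finset.sum_insert hw, B9Eq3131Pointwise.covDη_add, ih]

/-- **Support of `D*A`**: if the bond function `A` vanishes off the cube `Δ(y)`, then `(D^{η*}_UA)(x) = 0` unless `x ∈ Δ(y)` or
`x − e_μ ∈ Δ(y)` for some `μ` ((3.8): `(D*A)(x)` involves `A_μ(x)` and `A_μ(x − e_μ)` only).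
[cite: Balaban1985BackgroundPropagators, (3.8) p.392] -/
theorem divBη_eq_zero_of_far [Fintype ι] {Y : Type*} (blk : S → Y) (η : ℝ) {A : ι → S → 𝔸} {y : Y}
    (hA : ∀ μ x, blk x ≠ y → A μ x = 0) {x : S} (hx : blk x ≠ y) (hx' : ∀ μ, blk ((T μ).symm x) ≠ y) :
    divBη T U η A x = 0 := by
  rw [divBη_apply, divB]
  have h0 : ∀ μ, covDstar T U μ (A μ) x = 0 := fun μ => by
    rw [covDstar, hA μ x hx, hA μ _ (hx' μ), B9Eq39Adjoint.R_zero, sub_zero]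
  simp only [h0, Finset.sum_const_zero, smul_zero]

end Divergence

/-! ## §3 The SUP entries: `|(𝒢λ)(x)|`, `|(𝒢λ)(x + e_μ)|`, `|(∇_U𝒢λ)(x)|` for `𝒢 = G′R = G′ − G′P` and `λ` supported near `Δ(y′)` -/

section Sup

variable {𝔸 : Type*} [NormedRing 𝔸]
variable {S : Type*} [Fintype S]
variable {g : B6.Geometry} (blk : S → g.Site)

open Classical in
/-- **A majorant letter applied to a function supported near a cube** ((3.42)₁,₂ ∘ the block decomposition [4] (2.52), paraphrase ours: insert Σ_{y″}Δ(y″) = I): if the additive map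
`Φ` has the block majorant `K(y)e^{−δ₀d(y,y″)}` (print: `|(Φλ)(x)| ≦ K(y)e^{−δ₀d(y,y″)}|λ|` for `x ∈ Δ(y)`, `supp λ ⊂ Δ(y″)`) and `λ`
is supported in cubes within distance `r₀` of `Δ(y′)`, then `|(Φλ)(x)| ≦ c·e^{σr₀}·e^{δ₀r₀}·K(y)e^{−δ₀d(y,y′)}|λ|`.
[cite: Balaban1985BackgroundPropagators, (3.42) p.397, p.399; Balaban1984PropagatorsII, (2.52)–(2.55) p.232–233, (2.61) p.234] -/
theorem sup_of_near (Φ : (S → 𝔸) →+ (S → 𝔸)) {K : g.Site → ℝ} (hK : ∀ a, 0 ≤ K a) {δ₀ : ℝ} (hδ₀ : 0 ≤ δ₀)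
    (hΦ : ∀ (y'' : g.Site) (f : S → 𝔸) (B : ℝ), 0 ≤ B → (∀ x, blk x = y'' → ‖f x‖ ≤ B) → (∀ x, blk x ≠ y'' → f x = 0) →
      ∀ x, ‖Φ f x‖ ≤ K (blk x) * Real.exp (-(δ₀ * g.dist (blk x) y'')) * B)
    (hsym : DistSymm g) (htri : Triangle254 g) {σ c : ℝ} (hrow : RowSum g σ c) (hσ : 0 ≤ σ)
    {r₀ : ℝ} {f : S → 𝔸} {y' : g.Site} (hfs : ∀ x, f x ≠ 0 → g.dist (blk x) y' ≤ r₀) (x : S) :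
    ‖Φ f x‖ ≤ c * Real.exp (σ * r₀) * Real.exp (δ₀ * r₀) * K (blk x) * Real.exp (-(δ₀ * g.dist (blk x) y')) * ssup f := by
  -- decompose λ over the cubes and apply the letter piece by piece
  have hdec : Φ f x = ∑ y'' : g.Site, Φ (Set.indicator (blk ⁻¹' {y''}) f) x := by
    conv_lhs => rw [← sum_piece blk f]
    rw [map_sum, Finset.sum_apply]
  set E : ℝ := Real.exp (-(δ₀ * g.dist (blk x) y')) with hE
  set near : g.Site → Prop := fun b => g.dist b y' ≤ r₀ with hnear
  have hss := ssup_nonneg f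
  -- each piece: zero unless its cube carries a point of the support, which is then near y′
  have hpiece : ∀ y'' : g.Site, ‖Φ (Set.indicator (blk ⁻¹' {y''}) f) x‖ ≤
      if near y'' then K (blk x) * Real.exp (δ₀ * r₀) * E * ssup f else 0 := by
    intro y''
    by_cases hsupp : ∃ x', blk x' = y'' ∧ f x' ≠ 0
    · obtain ⟨x', hx'b, hx'f⟩ := hsupp
      have hny : near y'' := by rw [← hx'b]; exact hfs x' hx'f
      rw [if_pos hny]
      have h1 := hΦ y'' (Set.indicator (blk ⁻¹' {y''}) f) (ssup f) hss
        (fun z hz => (norm_piece_le blk y'' f z).trans (norm_le_ssup f z)) (fun z hz => piece_apply_of_ne blk f hz) x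
      refine h1.trans ?_
      have h2 : Real.exp (-(δ₀ * g.dist (blk x) y'')) ≤ Real.exp (δ₀ * r₀) * E := exp_near htri hδ₀ hny
      have := mul_le_mul_of_nonneg_left h2 (hK (blk x))
      calc K (blk x) * Real.exp (-(δ₀ * g.dist (blk x) y'')) * ssup f
          ≤ K (blk x) * (Real.exp (δ₀ * r₀) * E) * ssup f := mul_le_mul_of_nonneg_right this hss
        _ = K (blk x) * Real.exp (δ₀ * r₀) * E * ssup f := by ring
    · push Not at hsupp
      have hz : Set.indicator (blk ⁻¹' {y''}) f = 0 := piece_eq_zero blk fun z hz => hsupp z hz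
      rw [hz, map_zero, Pi.zero_apply, norm_zero]
      split_ifs
      · exact mul_nonneg (mul_nonneg (mul_nonneg (hK _) (Real.exp_nonneg _)) (Real.exp_nonneg _)) hss
      · exact le_rfl
  have hcount := count_near_le hsym hrow hσ r₀ y'
  calc ‖Φ f x‖ = ‖∑ y'' : g.Site, Φ (Set.indicator (blk ⁻¹' {y''}) f) x‖ := by rw [hdec]
    _ ≤ ∑ y'' : g.Site, ‖Φ (Set.indicator (blk ⁻¹' {y''}) f) x‖ := norm_sum_le _ _
    _ ≤ ∑ y'' : g.Site, (if near y'' then K (blk x) * Real.exp (δ₀ * r₀) * E * ssup f else 0) :=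
        Finset.sum_le_sum fun y'' _ => hpiece y''
    _ = (K (blk x) * Real.exp (δ₀ * r₀) * E * ssup f) * ∑ y'' : g.Site, (if near y'' then (1 : ℝ) else 0) := by
        rw [Finset.mul_sum]
        refine Finset.sum_congr rfl fun y'' _ => ?_
        split_ifs <;> simp
    _ ≤ (K (blk x) * Real.exp (δ₀ * r₀) * E * ssup f) * (c * Real.exp (σ * r₀)) :=
        mul_le_mul_of_nonneg_left hcount
          (mul_nonneg (mul_nonneg (mul_nonneg (hK _) (Real.exp_nonneg _)) (Real.exp_nonneg _)) hss)
    _ = c * Real.exp (σ * r₀) * Real.exp (δ₀ * r₀) * K (blk x) * E * ssup f := by ring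

omit [Fintype S] in
open Classical in
/-- **A majorant letter applied to a spread function with near sources** ((3.42) ∘ (3.49), the convolution of [4] (2.54) + (2.61)):
if `Φ` has the block majorant `K(y)e^{−δ₀d(y,y″)}` and `|h(z)| ≦ Σ_{b : d(b,y′) ≦ r₀} M·e^{−δ₁d(y_z,b)}` with `δ₁ + σ ≦ δ₀`, then
`|(Φh)(x)| ≦ c²e^{σr₀}e^{δ₁r₀}·K(y)·M·e^{−δ₁d(y,y′)}`.
[cite: Balaban1985BackgroundPropagators, (3.42) p.397, (3.49) p.399; Balaban1984PropagatorsII, (2.52)–(2.55) p.232–233, Lemma 2.1 (2.61) p.234] -/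
theorem sup_of_spread (Φ : (S → 𝔸) →+ (S → 𝔸)) {K : g.Site → ℝ} (hK : ∀ a, 0 ≤ K a) {δ₀ δ₁ : ℝ} (hδ₁ : 0 ≤ δ₁)
    (hΦ : ∀ (y'' : g.Site) (f : S → 𝔸) (B : ℝ), 0 ≤ B → (∀ x, blk x = y'' → ‖f x‖ ≤ B) → (∀ x, blk x ≠ y'' → f x = 0) →
      ∀ x, ‖Φ f x‖ ≤ K (blk x) * Real.exp (-(δ₀ * g.dist (blk x) y'')) * B)
    (hd : ∀ a b : g.Site, 0 ≤ g.dist a b) (hsym : DistSymm g) (htri : Triangle254 g) {σ c : ℝ} (hrow : RowSum g σ c)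
    (hσ : 0 ≤ σ) (hδ : δ₁ + σ ≤ δ₀)
    {r₀ M : ℝ} (hM : 0 ≤ M) {h : S → 𝔸} {y' : g.Site}
    (hh : ∀ z, ‖h z‖ ≤ ∑ b : g.Site, (if g.dist b y' ≤ r₀ then M * Real.exp (-(δ₁ * g.dist (blk z) b)) else 0)) (x : S) :
    ‖Φ h x‖ ≤ c * c * Real.exp (σ * r₀) * Real.exp (δ₁ * r₀) * K (blk x) * M * Real.exp (-(δ₁ * g.dist (blk x) y')) := by
  have hc : 0 ≤ c := hrow.nonneg y'
  have hdec : Φ h x = ∑ y'' : g.Site, Φ (Set.indicator (blk ⁻¹' {y''}) h) x := by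
    conv_lhs => rw [← sum_piece blk h]
    rw [map_sum, Finset.sum_apply]
  set E : ℝ := Real.exp (-(δ₁ * g.dist (blk x) y')) with hE
  -- the sup of the piece on Δ(y⁗)
  set Bd : g.Site → ℝ := fun y'' => ∑ b : g.Site, (if g.dist b y' ≤ r₀ then M * Real.exp (-(δ₁ * g.dist y'' b)) else 0) with hBd
  have hBd0 : ∀ y'', 0 ≤ Bd y'' := fun y'' =>
    Finset.sum_nonneg fun b _ => by split_ifs <;> [exact mul_nonneg hM (Real.exp_nonneg _); exact le_rfl]
  have hpiece : ∀ y'' : g.Site, ‖Φ (Set.indicator (blk ⁻¹' {y''}) h) x‖ ≤ K (blk x) * Real.exp (-(δ₀ * g.dist (blk x) y'')) * Bd y'' := by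
    intro y''
    refine hΦ y'' (Set.indicator (blk ⁻¹' {y''}) h) (Bd y'') (hBd0 y'') (fun z hz => ?_) (fun z hz => piece_apply_of_ne blk h hz) x
    rw [piece_apply_of_eq blk h hz]
    have := hh z
    rw [hz] at this
    exact this
  -- the convolution over the intermediate cube y⁗, source by source
  have hconv : ∀ b : g.Site, ∑ y'' : g.Site, Real.exp (-(δ₀ * g.dist (blk x) y'')) * Real.exp (-(δ₁ * g.dist y'' b)) ≤
      c * Real.exp (-(δ₁ * g.dist (blk x) b)) := fun b =>
    conv_exp_le htri hd hrow hδ₁ le_rfl hδ (blk x) b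
  have hcount := count_near_le hsym hrow hσ r₀ y'
  calc ‖Φ h x‖ = ‖∑ y'' : g.Site, Φ (Set.indicator (blk ⁻¹' {y''}) h) x‖ := by rw [hdec]
    _ ≤ ∑ y'' : g.Site, ‖Φ (Set.indicator (blk ⁻¹' {y''}) h) x‖ := norm_sum_le _ _
    _ ≤ ∑ y'' : g.Site, K (blk x) * Real.exp (-(δ₀ * g.dist (blk x) y'')) * Bd y'' := Finset.sum_le_sum fun y'' _ => hpiece y''
    _ = ∑ b : g.Site, (if g.dist b y' ≤ r₀ then
          K (blk x) * M * ∑ y'' : g.Site, Real.exp (-(δ₀ * g.dist (blk x) y'')) * Real.exp (-(δ₁ * g.dist y'' b)) else 0) := by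
        have hsw : ∀ y'' : g.Site, K (blk x) * Real.exp (-(δ₀ * g.dist (blk x) y'')) * Bd y'' =
            ∑ b : g.Site, (if g.dist b y' ≤ r₀ then
              K (blk x) * M * (Real.exp (-(δ₀ * g.dist (blk x) y'')) * Real.exp (-(δ₁ * g.dist y'' b))) else 0) := by
          intro y''
          simp only [hBd]
          rw [Finset.mul_sum]
          refine Finset.sum_congr rfl fun b _ => ?_
          split_ifs <;> ring
        rw [Finset.sum_congr rfl fun y'' _ => hsw y'', Finset.sum_comm]
        refine Finset.sum_congr rfl fun b _ => ?_
        split_ifs with hb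
        · rw [Finset.mul_sum]
        · simp
    _ ≤ ∑ b : g.Site, (if g.dist b y' ≤ r₀ then K (blk x) * M * (c * Real.exp (-(δ₁ * g.dist (blk x) b))) else 0) := by
        refine Finset.sum_le_sum fun b _ => ?_
        split_ifs with hb
        · exact mul_le_mul_of_nonneg_left (hconv b) (mul_nonneg (hK _) hM)
        · exact le_rfl
    _ ≤ ∑ b : g.Site, (if g.dist b y' ≤ r₀ then K (blk x) * M * (c * (Real.exp (δ₁ * r₀) * E)) else 0) := by
        refine Finset.sum_le_sum fun b _ => ?_
        split_ifs with hb
        · exact mul_le_mul_of_nonneg_left (mul_le_mul_of_nonneg_left (exp_near htri hδ₁ hb) hc) (mul_nonneg (hK _) hM)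
        · exact le_rfl
    _ = (K (blk x) * M * (c * (Real.exp (δ₁ * r₀) * E))) * ∑ b : g.Site, (if g.dist b y' ≤ r₀ then (1 : ℝ) else 0) := by
        rw [Finset.mul_sum]
        refine Finset.sum_congr rfl fun b _ => ?_
        split_ifs <;> simp
    _ ≤ (K (blk x) * M * (c * (Real.exp (δ₁ * r₀) * E))) * (c * Real.exp (σ * r₀)) :=
        mul_le_mul_of_nonneg_left hcount
          (mul_nonneg (mul_nonneg (hK _) hM) (mul_nonneg hc (mul_nonneg (Real.exp_nonneg _) (Real.exp_nonneg _))))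
    _ = c * c * Real.exp (σ * r₀) * Real.exp (δ₁ * r₀) * K (blk x) * M * E := by ring

end Sup


/-! ## §4 The (3.49) letter `P` applied to a function supported near a cube: sup and L¹ readings -/

section PSteps

variable {𝔸 : Type*} [NormedRing 𝔸]
variable {S : Type*} [Fintype S]
variable {g : B6.Geometry} (blk : S → g.Site)

open Classical in
/-- **Sup reading of (3.49)₁ on a function supported near `Δ(y′)`**: from the printed kernel bound
`|P(z,x′)| ≦ K_P(L^{j′}η)^{−d}e^{−δ₁d(y_z,y′)}` (`x′ ∈ Δ(y′)`; here `v(y′)` = the block volume `(L^{j′}η)^d ≧ η^d#Δ(y′)`) and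
`supp λ` within distance `r₀` of `Δ(y′)`: `|(Pλ)(z)| ≦ Σ_{b : d(b,y′) ≦ r₀} K_P|λ|e^{−δ₁d(y_z,b)}`.
[cite: Balaban1985BackgroundPropagators, (3.49) p.399, p.393; Balaban1984PropagatorsII, (2.64)–(2.66) p.234] -/
theorem norm_P_le_near (Pp : (S → 𝔸) →+ (S → 𝔸)) {η : ℝ} (hη : 0 ≤ η) (d : ℕ) {v : g.Site → ℝ} (hv : ∀ y, 0 < v y)
    (hvol : ∀ y : g.Site, η ^ d * ∑ x : S, (if blk x = y then (1 : ℝ) else 0) ≤ v y)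
    {KP δ₁ : ℝ} (hKP : 0 ≤ KP)
    (hP : ∀ (f : S → 𝔸) (z : S), ‖Pp f z‖ ≤
      ∑ x' : S, η ^ d * (KP * Real.exp (-(δ₁ * g.dist (blk z) (blk x'))) * (v (blk x'))⁻¹) * ‖f x'‖)
    {r₀ : ℝ} {f : S → 𝔸} {y' : g.Site} (hfs : ∀ x, f x ≠ 0 → g.dist (blk x) y' ≤ r₀) (z : S) :
    ‖Pp f z‖ ≤ ∑ b : g.Site, (if g.dist b y' ≤ r₀ then KP * ssup f * Real.exp (-(δ₁ * g.dist (blk z) b)) else 0) := by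
  have hss := ssup_nonneg f
  refine (hP f z).trans ?_
  -- regroup the sum over x′ cube by cube
  have hre : ∑ x' : S, η ^ d * (KP * Real.exp (-(δ₁ * g.dist (blk z) (blk x'))) * (v (blk x'))⁻¹) * ‖f x'‖ =
      ∑ b : g.Site, (KP * Real.exp (-(δ₁ * g.dist (blk z) b)) * (v b)⁻¹) *
        ∑ x' : S, (if blk x' = b then η ^ d * ‖f x'‖ else 0) := by
    rw [← sum_mul_eq_sum_fiber blk (fun b => KP * Real.exp (-(δ₁ * g.dist (blk z) b)) * (v b)⁻¹) (fun x' => η ^ d * ‖f x'‖)]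
    refine Finset.sum_congr rfl fun x' _ => ?_
    ring
  rw [hre]
  refine Finset.sum_le_sum fun b _ => ?_
  -- the L¹ mass of λ on Δ(b) is ≦ v(b)|λ| and vanishes unless Δ(b) meets the support
  by_cases hsupp : ∃ x', blk x' = b ∧ f x' ≠ 0
  · obtain ⟨x', hx'b, hx'f⟩ := hsupp
    have hnb : g.dist b y' ≤ r₀ := by rw [← hx'b]; exact hfs x' hx'f
    rw [if_pos hnb]
    have hmass : ∑ x'' : S, (if blk x'' = b then η ^ d * ‖f x''‖ else 0) ≤ v b * ssup f := by
      calc ∑ x'' : S, (if blk x'' = b then η ^ d * ‖f x''‖ else 0)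
          ≤ ∑ x'' : S, (if blk x'' = b then η ^ d * ssup f else 0) := by
            refine Finset.sum_le_sum fun x'' _ => ?_
            split_ifs
            · exact mul_le_mul_of_nonneg_left (norm_le_ssup f x'') (pow_nonneg hη d)
            · exact le_rfl
        _ = (η ^ d * ∑ x'' : S, (if blk x'' = b then (1 : ℝ) else 0)) * ssup f := by
            rw [Finset.mul_sum, Finset.sum_mul]
            refine Finset.sum_congr rfl fun x'' _ => ?_
            split_ifs <;> ring
        _ ≤ v b * ssup f := mul_le_mul_of_nonneg_right (hvol b) hss
    have hcoef : 0 ≤ KP * Real.exp (-(δ₁ * g.dist (blk z) b)) * (v b)⁻¹ :=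
      mul_nonneg (mul_nonneg hKP (Real.exp_nonneg _)) (inv_nonneg.mpr (hv b).le)
    calc KP * Real.exp (-(δ₁ * g.dist (blk z) b)) * (v b)⁻¹ * ∑ x'' : S, (if blk x'' = b then η ^ d * ‖f x''‖ else 0)
        ≤ KP * Real.exp (-(δ₁ * g.dist (blk z) b)) * (v b)⁻¹ * (v b * ssup f) := mul_le_mul_of_nonneg_left hmass hcoef
      _ = KP * ssup f * Real.exp (-(δ₁ * g.dist (blk z) b)) := by
          have hvb : v b ≠ 0 := (hv b).ne'
          field_simp
  · push Not at hsupp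
    have hzero : ∑ x'' : S, (if blk x'' = b then η ^ d * ‖f x''‖ else 0) = 0 := by
      refine Finset.sum_eq_zero fun x'' _ => ?_
      split_ifs with hx
      · rw [hsupp x'' hx, norm_zero, mul_zero]
      · rfl
    rw [hzero, mul_zero]
    split_ifs
    · exact mul_nonneg (mul_nonneg hKP hss) (Real.exp_nonneg _)
    · exact le_rfl

open Classical in
/-- **L¹ reading of (3.49)₁ on a function supported near `Δ(y)`**: from the kernel bound in the ROW-volume form
`|P(z,x′)| ≦ K_P(L^{j}η)^{−d}e^{−δ₁d(y_z,y_{x′})}` (`z ∈ Δ(y_z)`; = (3.49)₁ for the adjoint kernel, i.e. (3.49)₁ itself by the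
symmetry of `P = I − R`, `R` the orthogonal projection of (3.21), p. 394) and `supp λ` within distance `r₀` of `Δ(y)`:
`‖Pλ‖_{L¹(Δ(y⁗))} ≦ K_Pe^{δ₁r₀}e^{−δ₁d(y⁗,y)}‖λ‖_{L¹}` (`δ₁ ≧ 0`).
[cite: Balaban1985BackgroundPropagators, (3.49) p.399, (3.21) p.394, p.393; Balaban1984PropagatorsII, (2.54) p.233, (2.64)–(2.66) p.234] -/
theorem sl1On_P_le_near (Pp : (S → 𝔸) →+ (S → 𝔸)) {η : ℝ} (hη : 0 ≤ η) (d : ℕ) {v : g.Site → ℝ} (hv : ∀ y, 0 < v y)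
    (hvol : ∀ y : g.Site, η ^ d * ∑ x : S, (if blk x = y then (1 : ℝ) else 0) ≤ v y)
    {KP δ₁ : ℝ} (hKP : 0 ≤ KP) (hδ₁ : 0 ≤ δ₁)
    (hPt : ∀ (f : S → 𝔸) (z : S), ‖Pp f z‖ ≤
      ∑ x' : S, η ^ d * (KP * Real.exp (-(δ₁ * g.dist (blk z) (blk x'))) * (v (blk z))⁻¹) * ‖f x'‖)
    (htri : Triangle254 g)
    {r₀ : ℝ} {f : S → 𝔸} {y : g.Site} (hfs : ∀ x, f x ≠ 0 → g.dist (blk x) y ≤ r₀) (y'' : g.Site) :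
    sl1On blk η d y'' (Pp f) ≤ KP * Real.exp (δ₁ * r₀) * Real.exp (-(δ₁ * g.dist y'' y)) * sl1 η d f := by
  have hηd : 0 ≤ η ^ d := pow_nonneg hη d
  set E : ℝ := Real.exp (-(δ₁ * g.dist y'' y)) with hE
  -- pointwise on Δ(y⁗): the row-volume kernel bound, the source moved from y_{x′} to y
  have hpt : ∀ z, blk z = y'' → ‖Pp f z‖ ≤ (v y'')⁻¹ * (KP * Real.exp (δ₁ * r₀) * E) * ∑ x' : S, η ^ d * ‖f x'‖ := by
    intro z hz
    refine (hPt f z).trans ?_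
    rw [hz, Finset.mul_sum]
    refine Finset.sum_le_sum fun x' _ => ?_
    by_cases hx' : f x' = 0
    · rw [hx', norm_zero, mul_zero, mul_zero, mul_zero]
    · have hnear : g.dist (blk x') y ≤ r₀ := hfs x' hx'
      have hex : Real.exp (-(δ₁ * g.dist y'' (blk x'))) ≤ Real.exp (δ₁ * r₀) * E := exp_near htri hδ₁ hnear
      have h1 : η ^ d * (KP * Real.exp (-(δ₁ * g.dist y'' (blk x'))) * (v y'')⁻¹) * ‖f x'‖ ≤
          η ^ d * (KP * (Real.exp (δ₁ * r₀) * E) * (v y'')⁻¹) * ‖f x'‖ :=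
        mul_le_mul_of_nonneg_right
          (mul_le_mul_of_nonneg_left
            (mul_le_mul_of_nonneg_right (mul_le_mul_of_nonneg_left hex hKP) (inv_nonneg.mpr (hv _).le)) hηd)
          (norm_nonneg _)
      refine h1.trans (le_of_eq ?_)
      ring
  -- sum over Δ(y⁗): the volume factor η^d#Δ(y⁗)·v(y⁗)⁻¹ ≦ 1
  rw [sl1On_def, sl1]
  have hcnt0 : 0 ≤ ∑ x : S, (if blk x = y'' then (1 : ℝ) else 0) :=
    Finset.sum_nonneg fun x _ => by split_ifs <;> norm_num
  have hS0 : 0 ≤ ∑ x' : S, η ^ d * ‖f x'‖ := Finset.sum_nonneg fun x' _ => mul_nonneg hηd (norm_nonneg _)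
  have hM0 : 0 ≤ KP * Real.exp (δ₁ * r₀) * E := mul_nonneg (mul_nonneg hKP (Real.exp_nonneg _)) (Real.exp_nonneg _)
  set M : ℝ := KP * Real.exp (δ₁ * r₀) * E with hM
  set Sf : ℝ := ∑ x' : S, η ^ d * ‖f x'‖ with hSf
  calc η ^ d * ∑ z : S, (if blk z = y'' then ‖Pp f z‖ else 0)
      ≤ η ^ d * ∑ z : S, (if blk z = y'' then (v y'')⁻¹ * M * Sf else 0) := by
        refine mul_le_mul_of_nonneg_left (Finset.sum_le_sum fun z _ => ?_) hηd
        split_ifs with hz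
        · exact hpt z hz
        · exact le_rfl
    _ = η ^ d * ((∑ z : S, (if blk z = y'' then (1 : ℝ) else 0)) * ((v y'')⁻¹ * M * Sf)) := by
        congr 1
        rw [Finset.sum_mul]
        refine Finset.sum_congr rfl fun z _ => ?_
        split_ifs <;> ring
    _ = (η ^ d * ∑ z : S, (if blk z = y'' then (1 : ℝ) else 0)) * (v y'')⁻¹ * (M * Sf) := by ring
    _ ≤ v y'' * (v y'')⁻¹ * (M * Sf) :=
        mul_le_mul_of_nonneg_right (mul_le_mul_of_nonneg_right (hvol y'') (inv_nonneg.mpr (hv _).le)) (mul_nonneg hM0 hS0)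
    _ = M * (η ^ d * ∑ x' : S, ‖f x'‖) := by
        rw [mul_inv_cancel₀ (hv y'').ne', one_mul, hSf, ← Finset.mul_sum]

end PSteps


/-! ## §5 The three SUP entries of `𝒢λ = G′Rλ = G′λ − G′Pλ` for `λ` supported near `Δ(y′)` -/

section SupEntries

variable {𝔸 : Type*} [NormedRing 𝔸]
variable {S : Type*} [Fintype S]
variable {g : B6.Geometry} (blk : S → g.Site)

open Classical in
/-- **The generic sup entry** (print: Theorem 3.1 for `G′` composed with `R = I − P` by (3.49), *"using again Lemma 2.1"*): for an
additive `Φ` with the block majorant `K(y)e^{−δ₀d}` ((3.42) shape), the (3.49)₁ letter `P` (column-volume kernel reading), rates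
`δ₁ + σ ≦ δ₀`, and `λ` supported in cubes within distance `r₀` of `Δ(y′)`:
`|(Φ(λ − Pλ))(x)| ≦ c·e^{σr₀}(e^{δ₀r₀} + cK_Pe^{δ₁r₀})·K(y)·e^{−δ₁d(y,y′)}·|λ|`, `x ∈ Δ(y)`.
[cite: Balaban1985BackgroundPropagators, (3.42) p.397, (3.49) p.399, p.421; Balaban1984PropagatorsII, (2.52)–(2.55) p.232–233, Lemma 2.1 (2.61) p.234] -/
theorem sup_entry (Φ Pp : (S → 𝔸) →+ (S → 𝔸)) {K : g.Site → ℝ} (hK : ∀ a, 0 ≤ K a) {δ₀ δ₁ : ℝ} (hδ₁ : 0 ≤ δ₁)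
    (hΦ : ∀ (y'' : g.Site) (f : S → 𝔸) (B : ℝ), 0 ≤ B → (∀ x, blk x = y'' → ‖f x‖ ≤ B) → (∀ x, blk x ≠ y'' → f x = 0) →
      ∀ x, ‖Φ f x‖ ≤ K (blk x) * Real.exp (-(δ₀ * g.dist (blk x) y'')) * B)
    {η : ℝ} (hη : 0 ≤ η) (d : ℕ) {v : g.Site → ℝ} (hv : ∀ y, 0 < v y)
    (hvol : ∀ y : g.Site, η ^ d * ∑ x : S, (if blk x = y then (1 : ℝ) else 0) ≤ v y)
    {KP : ℝ} (hKP : 0 ≤ KP)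
    (hP : ∀ (f : S → 𝔸) (z : S), ‖Pp f z‖ ≤
      ∑ x' : S, η ^ d * (KP * Real.exp (-(δ₁ * g.dist (blk z) (blk x'))) * (v (blk x'))⁻¹) * ‖f x'‖)
    (hd : ∀ a b : g.Site, 0 ≤ g.dist a b) (hsym : DistSymm g) (htri : Triangle254 g) {σ c : ℝ} (hrow : RowSum g σ c)
    (hσ : 0 ≤ σ) (hδ : δ₁ + σ ≤ δ₀)
    {r₀ : ℝ} {f : S → 𝔸} {y' : g.Site} (hfs : ∀ x, f x ≠ 0 → g.dist (blk x) y' ≤ r₀) (x : S) :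
    ‖Φ (f - Pp f) x‖ ≤ c * Real.exp (σ * r₀) * (Real.exp (δ₀ * r₀) + c * KP * Real.exp (δ₁ * r₀)) * K (blk x) *
      Real.exp (-(δ₁ * g.dist (blk x) y')) * ssup f := by
  have hδ₀ : 0 ≤ δ₀ := by linarith
  have hc : 0 ≤ c := hrow.nonneg y'
  have hss := ssup_nonneg f
  set E₁ : ℝ := Real.exp (-(δ₁ * g.dist (blk x) y')) with hE₁
  -- G′λ: the letter on the pieces of λ near Δ(y′), at the full rate δ₀ ≧ δ₁
  have h1 := sup_of_near blk Φ hK hδ₀ hΦ hsym htri hrow hσ hfs x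
  have hE : Real.exp (-(δ₀ * g.dist (blk x) y')) ≤ E₁ := exp_rate_le (by linarith) (hd _ _)
  have h1' : ‖Φ f x‖ ≤ c * Real.exp (σ * r₀) * Real.exp (δ₀ * r₀) * K (blk x) * E₁ * ssup f := by
    refine h1.trans (mul_le_mul_of_nonneg_right (mul_le_mul_of_nonneg_left hE ?_) hss)
    exact mul_nonneg (mul_nonneg (mul_nonneg hc (Real.exp_nonneg _)) (Real.exp_nonneg _)) (hK _)
  -- G′Pλ: the letter on the spread function Pλ with near sources
  have hh := norm_P_le_near blk Pp hη d hv hvol hKP hP hfs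
  have h2 := sup_of_spread blk Φ hK hδ₁ hΦ hd hsym htri hrow hσ hδ (mul_nonneg hKP hss) hh x
  rw [map_sub, Pi.sub_apply]
  refine (norm_sub_le _ _).trans ?_
  have := add_le_add h1' h2
  refine this.trans (le_of_eq ?_)
  ring

end SupEntries

section SupEntriesLattice

variable {𝔸 : Type*} [NormedRing 𝔸] [NormedAlgebra ℂ 𝔸]
variable {S : Type*} [Fintype S] {ι : Type*}
variable (T : ι → Equiv.Perm S) (U : ι → S → 𝔸ˣ)
variable {g : B6.Geometry} (blk : S → g.Site)

omit [NormedAlgebra ℂ 𝔸] in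
open Classical in
/-- **Sup entry `|(G′Rλ)(x)|`** ((3.42)₁ ∘ (3.49), the `hS0` input of `B9Ineq3131Assembly.ineq3131_assembled` at rate `δ₁`): from the
(3.42)₁ block majorant `B_G(Lʲη)²e^{−δ₀d}` of `G′`, the (3.49)₁ letter `P`, `δ₁ + σ ≦ δ₀`, and `supp λ` within `r₀` of `Δ(y′)`:
`|(G′(λ − Pλ))(x)| ≦ C_S(Lʲη)²e^{−δ₁d(y,y′)}|λ|` with `C_S = ce^{σr₀}(e^{δ₀r₀} + cK_Pe^{δ₁r₀})B_G`.
[cite: Balaban1985BackgroundPropagators, (3.42) p.397, (3.49) p.399, (3.131) p.422; Balaban1984PropagatorsII, Lemma 2.1 p.234] -/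
theorem sup_entry0 (Gp Pp : (S → 𝔸) →+ (S → 𝔸)) {BG δ₀ δ₁ : ℝ} (hBG : 0 ≤ BG) (hδ₁ : 0 ≤ δ₁)
    (hG0 : ∀ (y'' : g.Site) (f : S → 𝔸) (B : ℝ), 0 ≤ B → (∀ x, blk x = y'' → ‖f x‖ ≤ B) → (∀ x, blk x ≠ y'' → f x = 0) →
      ∀ x, ‖Gp f x‖ ≤ BG * g.len (blk x) ^ 2 * Real.exp (-(δ₀ * g.dist (blk x) y'')) * B)
    {η : ℝ} (hη : 0 ≤ η) (d : ℕ) {v : g.Site → ℝ} (hv : ∀ y, 0 < v y)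
    (hvol : ∀ y : g.Site, η ^ d * ∑ x : S, (if blk x = y then (1 : ℝ) else 0) ≤ v y)
    {KP : ℝ} (hKP : 0 ≤ KP)
    (hP : ∀ (f : S → 𝔸) (z : S), ‖Pp f z‖ ≤
      ∑ x' : S, η ^ d * (KP * Real.exp (-(δ₁ * g.dist (blk z) (blk x'))) * (v (blk x'))⁻¹) * ‖f x'‖)
    (hd : ∀ a b : g.Site, 0 ≤ g.dist a b) (hsym : DistSymm g) (htri : Triangle254 g) {σ c : ℝ} (hrow : RowSum g σ c)
    (hσ : 0 ≤ σ) (hδ : δ₁ + σ ≤ δ₀)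
    {r₀ : ℝ} {f : S → 𝔸} {y' : g.Site} (hfs : ∀ x, f x ≠ 0 → g.dist (blk x) y' ≤ r₀) (x : S) :
    ‖Gp (f - Pp f) x‖ ≤ c * Real.exp (σ * r₀) * (Real.exp (δ₀ * r₀) + c * KP * Real.exp (δ₁ * r₀)) * BG *
      g.len (blk x) ^ 2 * Real.exp (-(δ₁ * g.dist (blk x) y')) * ssup f := by
  have h := sup_entry blk Gp Pp (K := fun a => BG * g.len a ^ 2) (fun a => mul_nonneg hBG (pow_two_nonneg _)) hδ₁ hG0
    hη d hv hvol hKP hP hd hsym htri hrow hσ hδ hfs x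
  refine h.trans (le_of_eq ?_)
  ring

omit [NormedAlgebra ℂ 𝔸] in
open Classical in
/-- **Sup entry on the unit translates `|(G′Rλ)(x + e_μ)|`** (the `hS0s` input; print's cubes `Δ̃(y)` of p. 397 contain the
translates): under the block-map geometry `d(y_x, y_{x+e_μ}) ≦ r₀`, `L^{j(x+e_μ)}η ≦ Λ_T·L^{j(x)}η` (neighbouring cubes differ by at most
one level, (2.2) of [4]): `|(G′(λ − Pλ))(x + e_μ)| ≦ C_SΛ_T²e^{δ₁r₀}(Lʲη)²e^{−δ₁d(y,y′)}|λ|`, `x ∈ Δ(y)`.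
[cite: Balaban1985BackgroundPropagators, (3.42) p.397, p.397 (Δ̃(y)), (3.49) p.399, (3.131) p.422; Balaban1984PropagatorsII, (2.2) p.224, Lemma 2.1 p.234] -/
theorem sup_entry0_shift (Gp Pp : (S → 𝔸) →+ (S → 𝔸)) {BG δ₀ δ₁ : ℝ} (hBG : 0 ≤ BG) (hδ₁ : 0 ≤ δ₁)
    (hG0 : ∀ (y'' : g.Site) (f : S → 𝔸) (B : ℝ), 0 ≤ B → (∀ x, blk x = y'' → ‖f x‖ ≤ B) → (∀ x, blk x ≠ y'' → f x = 0) →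
      ∀ x, ‖Gp f x‖ ≤ BG * g.len (blk x) ^ 2 * Real.exp (-(δ₀ * g.dist (blk x) y'')) * B)
    {η : ℝ} (hη : 0 ≤ η) (d : ℕ) {v : g.Site → ℝ} (hv : ∀ y, 0 < v y)
    (hvol : ∀ y : g.Site, η ^ d * ∑ x : S, (if blk x = y then (1 : ℝ) else 0) ≤ v y)
    {KP : ℝ} (hKP : 0 ≤ KP)
    (hP : ∀ (f : S → 𝔸) (z : S), ‖Pp f z‖ ≤
      ∑ x' : S, η ^ d * (KP * Real.exp (-(δ₁ * g.dist (blk z) (blk x'))) * (v (blk x'))⁻¹) * ‖f x'‖)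
    (hd : ∀ a b : g.Site, 0 ≤ g.dist a b) (hsym : DistSymm g) (htri : Triangle254 g) {σ c : ℝ} (hrow : RowSum g σ c)
    (hσ : 0 ≤ σ) (hδ : δ₁ + σ ≤ δ₀) (hL : 1 ≤ g.L) (hge : 0 < g.eta)
    {r₀ ΛT : ℝ} (hnb : ∀ μ x, g.dist (blk x) (blk (T μ x)) ≤ r₀)
    (hnbl : ∀ μ x, g.len (blk (T μ x)) ≤ ΛT * g.len (blk x))
    {f : S → 𝔸} {y' : g.Site} (hfs : ∀ x, f x ≠ 0 → g.dist (blk x) y' ≤ r₀) (μ : ι) (x : S) :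
    ‖Gp (f - Pp f) (T μ x)‖ ≤ c * Real.exp (σ * r₀) * (Real.exp (δ₀ * r₀) + c * KP * Real.exp (δ₁ * r₀)) * BG *
      ΛT ^ 2 * Real.exp (δ₁ * r₀) * g.len (blk x) ^ 2 * Real.exp (-(δ₁ * g.dist (blk x) y')) * ssup f := by
  have h := sup_entry0 blk Gp Pp hBG hδ₁ hG0 hη d hv hvol hKP hP hd hsym htri hrow hσ hδ hfs (T μ x)
  have hc : 0 ≤ c := hrow.nonneg y'
  have hss := ssup_nonneg f
  set C : ℝ := c * Real.exp (σ * r₀) * (Real.exp (δ₀ * r₀) + c * KP * Real.exp (δ₁ * r₀)) * BG with hC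
  have hC0 : 0 ≤ C := mul_nonneg (mul_nonneg (mul_nonneg hc (Real.exp_nonneg _))
    (add_nonneg (Real.exp_nonneg _) (mul_nonneg (mul_nonneg hc hKP) (Real.exp_nonneg _)))) hBG
  have hlen0 : 0 ≤ g.len (blk x) := (len_pos hL hge _).le
  have hlen : g.len (blk (T μ x)) ^ 2 ≤ ΛT ^ 2 * g.len (blk x) ^ 2 := by
    rw [← mul_pow]
    exact pow_le_pow_left₀ (len_pos hL hge _).le (hnbl μ x) 2
  have hex : Real.exp (-(δ₁ * g.dist (blk (T μ x)) y')) ≤ Real.exp (δ₁ * r₀) * Real.exp (-(δ₁ * g.dist (blk x) y')) :=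
    exp_near' htri hδ₁ (hnb μ x)
  calc ‖Gp (f - Pp f) (T μ x)‖
      ≤ C * g.len (blk (T μ x)) ^ 2 * Real.exp (-(δ₁ * g.dist (blk (T μ x)) y')) * ssup f := h
    _ ≤ C * (ΛT ^ 2 * g.len (blk x) ^ 2) * (Real.exp (δ₁ * r₀) * Real.exp (-(δ₁ * g.dist (blk x) y'))) * ssup f := by
        refine mul_le_mul_of_nonneg_right ?_ hss
        exact mul_le_mul (mul_le_mul_of_nonneg_left hlen hC0) hex (Real.exp_nonneg _)
          (mul_nonneg hC0 (mul_nonneg (pow_two_nonneg _) (pow_two_nonneg _)))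
    _ = C * ΛT ^ 2 * Real.exp (δ₁ * r₀) * g.len (blk x) ^ 2 * Real.exp (-(δ₁ * g.dist (blk x) y')) * ssup f := by ring

open Classical in
/-- **Sup entry `|(∇_UG′Rλ)(x)|`** ((3.42)₂ ∘ (3.49), the `hS1` input): from the (3.42)₂ block majorant `B_G(Lʲη)e^{−δ₀d}` of
`∇_UG′ = D^η_U ∘ G′`, the (3.49)₁ letter `P`, `δ₁ + σ ≦ δ₀`, `supp λ` within `r₀` of `Δ(y′)`:
`|(D^η_U G′(λ − Pλ))_μ(x)| ≦ C_S(Lʲη)e^{−δ₁d(y,y′)}|λ|`.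
[cite: Balaban1985BackgroundPropagators, (3.42) p.397, (3.3) p.391, (3.49) p.399, (3.131) p.422; Balaban1984PropagatorsII, Lemma 2.1 p.234] -/
theorem sup_entry1 (Gp Pp : (S → 𝔸) →+ (S → 𝔸)) {BG δ₀ δ₁ : ℝ} (hBG : 0 ≤ BG) (hδ₁ : 0 ≤ δ₁) (η : ℝ)
    (hG1 : ∀ (y'' : g.Site) (f : S → 𝔸) (B : ℝ), 0 ≤ B → (∀ x, blk x = y'' → ‖f x‖ ≤ B) → (∀ x, blk x ≠ y'' → f x = 0) →
      ∀ μ x, ‖covDη T U η (Gp f) μ x‖ ≤ BG * g.len (blk x) * Real.exp (-(δ₀ * g.dist (blk x) y'')) * B)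
    (hη : 0 ≤ η) (d : ℕ) {v : g.Site → ℝ} (hv : ∀ y, 0 < v y)
    (hvol : ∀ y : g.Site, η ^ d * ∑ x : S, (if blk x = y then (1 : ℝ) else 0) ≤ v y)
    {KP : ℝ} (hKP : 0 ≤ KP)
    (hP : ∀ (f : S → 𝔸) (z : S), ‖Pp f z‖ ≤
      ∑ x' : S, η ^ d * (KP * Real.exp (-(δ₁ * g.dist (blk z) (blk x'))) * (v (blk x'))⁻¹) * ‖f x'‖)
    (hd : ∀ a b : g.Site, 0 ≤ g.dist a b) (hsym : DistSymm g) (htri : Triangle254 g) {σ c : ℝ} (hrow : RowSum g σ c)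
    (hσ : 0 ≤ σ) (hδ : δ₁ + σ ≤ δ₀) (hL : 1 ≤ g.L) (hge : 0 < g.eta)
    {r₀ : ℝ} {f : S → 𝔸} {y' : g.Site} (hfs : ∀ x, f x ≠ 0 → g.dist (blk x) y' ≤ r₀) (μ : ι) (x : S) :
    ‖covDη T U η (Gp (f - Pp f)) μ x‖ ≤ c * Real.exp (σ * r₀) * (Real.exp (δ₀ * r₀) + c * KP * Real.exp (δ₁ * r₀)) * BG *
      g.len (blk x) * Real.exp (-(δ₁ * g.dist (blk x) y')) * ssup f := by
  -- the additive map λ ↦ (D^η_U G′λ)_μ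
  let Φ : (S → 𝔸) →+ (S → 𝔸) :=
    { toFun := fun h z => covDη T U η (Gp h) μ z
      map_zero' := by
        funext z
        rw [map_zero, B9Eq3117Current.covDη_apply, B9Eq39Adjoint.covD_zero, smul_zero]; rfl
      map_add' := fun h₁ h₂ => by
        funext z
        rw [map_add, Pi.add_apply, B9Eq3131Pointwise.covDη_add] }
  have hΦ : ∀ (y'' : g.Site) (f : S → 𝔸) (B : ℝ), 0 ≤ B → (∀ x, blk x = y'' → ‖f x‖ ≤ B) → (∀ x, blk x ≠ y'' → f x = 0) →
      ∀ x, ‖Φ f x‖ ≤ (BG * g.len (blk x)) * Real.exp (-(δ₀ * g.dist (blk x) y'')) * B :=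
    fun y'' f B hB hfB hf0 x => hG1 y'' f B hB hfB hf0 μ x
  have h := sup_entry blk Φ Pp (K := fun a => BG * g.len a) (fun a => mul_nonneg hBG (len_pos hL hge a).le) hδ₁ hΦ
    hη d hv hvol hKP hP hd hsym htri hrow hσ hδ hfs x
  have hΦap : Φ (f - Pp f) x = covDη T U η (Gp (f - Pp f)) μ x := rfl
  rw [← hΦap]
  refine h.trans (le_of_eq ?_)
  ring

end SupEntriesLattice

/-! ## §6 The three L¹ (dual) entries of `𝒢λ = G′Rλ` for `λ` supported near `Δ(y)` -/

section L1Entries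

variable {𝔸 : Type*} [NormedRing 𝔸]
variable {S : Type*} [Fintype S]
variable {g : B6.Geometry} (blk : S → g.Site)

open Classical in
/-- **The generic L¹ entry** (print: the dual of Theorem 3.1's sup entries for the symmetric `G′`, composed with `R = I − P` by (3.49) and
the p. 398 scale transfer [4] (2.60)): for a block seminorm family `N(y″, ·)` (subadditive) with the dual letter
`N(y″, G′λ) ≦ B_G(Lʲη)^pe^{−δ₀d(y,y″)}‖λ‖_{L¹}` (`supp λ ⊂ Δ(y)`), the (3.49)₁ letter `P` in the row-volume reading, rates
`δ₁ − αδ₀ + σ ≦ δ₀`, `αδ₀ ≦ δ₁`, the transfer `p·log L ≦ αδ₀RM`, and `λ` supported in cubes within `r₀` of `Δ(y)` of size `≦ Λ_T·Lʲη`: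
`N(y″, λ − Pλ) ≦ B_G(Λ_T^pe^{δ₀r₀} + L^pcK_Pe^{δ₁r₀})(Lʲη)^pe^{−(δ₁−αδ₀)d(y,y″)}‖λ‖_{L¹}`.
[cite: Balaban1985BackgroundPropagators, (3.42) p.397, p.398, (3.49) p.399, (3.131) p.422; Balaban1984PropagatorsII, (2.52)–(2.55) p.232–233, Lemma 2.1 (2.60)–(2.61) p.234] -/
theorem l1_entry (N : g.Site → (S → 𝔸) → ℝ) (Pp : (S → 𝔸) →+ (S → 𝔸))
    (hNsub : ∀ y'' (f h : S → 𝔸), N y'' (f - h) ≤ N y'' f + N y'' h)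
    (hNsum : ∀ y'' (s : Finset g.Site) (F : g.Site → S → 𝔸), N y'' (∑ w ∈ s, F w) ≤ ∑ w ∈ s, N y'' (F w))
    (p : ℕ) {BG δ₀ δ₁ α : ℝ} (hBG : 0 ≤ BG) (hδ₁ : 0 ≤ δ₁) {η : ℝ} (hη : 0 ≤ η) (d : ℕ)
    (hNd : ∀ (y y'' : g.Site) (f : S → 𝔸), (∀ x, blk x ≠ y → f x = 0) →
      N y'' f ≤ BG * g.len y ^ p * Real.exp (-(δ₀ * g.dist y y'')) * sl1 η d f)
    {v : g.Site → ℝ} (hv : ∀ y, 0 < v y)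
    (hvol : ∀ y : g.Site, η ^ d * ∑ x : S, (if blk x = y then (1 : ℝ) else 0) ≤ v y)
    {KP : ℝ} (hKP : 0 ≤ KP)
    (hPt : ∀ (f : S → 𝔸) (z : S), ‖Pp f z‖ ≤
      ∑ x' : S, η ^ d * (KP * Real.exp (-(δ₁ * g.dist (blk z) (blk x'))) * (v (blk z))⁻¹) * ‖f x'‖)
    (hd : ∀ a b : g.Site, 0 ≤ g.dist a b) (hsym : DistSymm g) (htri : Triangle254 g) {σ c : ℝ} (hrow : RowSum g σ c)
    (hσ : 0 ≤ σ) (h260 : Ineq260 g δ₀ α) (hαδ : 0 ≤ α * δ₀) (hαδ₁ : α * δ₀ ≤ δ₁) (hδ : δ₁ - α * δ₀ + σ ≤ δ₀)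
    (hL : 1 ≤ g.L) (hge : 0 < g.eta) (hRM : (p : ℝ) * Real.log g.L ≤ α * δ₀ * g.R * g.M)
    {r₀ ΛT : ℝ} (hΛT : 0 ≤ ΛT) {f : S → 𝔸} {y : g.Site}
    (hfs : ∀ x, f x ≠ 0 → g.dist (blk x) y ≤ r₀ ∧ g.len (blk x) ≤ ΛT * g.len y) (y'' : g.Site) :
    N y'' (f - Pp f) ≤ BG * (ΛT ^ p * Real.exp (δ₀ * r₀) + g.L ^ p * c * KP * Real.exp (δ₁ * r₀)) * g.len y ^ p *
      Real.exp (-((δ₁ - α * δ₀) * g.dist y y'')) * sl1 η d f := by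
  have hδ₀ : 0 ≤ δ₀ := by linarith
  have hc : 0 ≤ c := hrow.nonneg y
  have hsl := sl1_nonneg hη d f
  have hleny : 0 ≤ g.len y := (len_pos hL hge y).le
  have hLnn : 0 ≤ g.L := zero_le_one.trans hL
  set δL : ℝ := δ₁ - α * δ₀ with hδL
  have hδL0 : 0 ≤ δL := by rw [hδL]; linarith
  set E : ℝ := Real.exp (-(δL * g.dist y y'')) with hE
  set E₀ : ℝ := Real.exp (-(δ₀ * g.dist y y'')) with hE₀
  have hE₀E : E₀ ≤ E := exp_rate_le (by rw [hδL]; linarith) (hd _ _)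
  -- (i) G′λ, piece by piece over the cubes carrying the support of λ
  have h1 : N y'' f ≤ BG * ΛT ^ p * Real.exp (δ₀ * r₀) * g.len y ^ p * E₀ * sl1 η d f := by
    have hdec : N y'' f ≤ ∑ y₃ : g.Site, N y'' (Set.indicator (blk ⁻¹' {y₃}) f) := by
      conv_lhs => rw [← sum_piece blk f]
      exact hNsum y'' Finset.univ (fun y₃ => Set.indicator (blk ⁻¹' {y₃}) f)
    refine hdec.trans ?_
    have hterm : ∀ y₃ : g.Site, N y'' (Set.indicator (blk ⁻¹' {y₃}) f) ≤
        BG * ΛT ^ p * Real.exp (δ₀ * r₀) * g.len y ^ p * E₀ * sl1 η d (Set.indicator (blk ⁻¹' {y₃}) f) := by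
      intro y₃
      have hN := hNd y₃ y'' (Set.indicator (blk ⁻¹' {y₃}) f) (fun z hz => piece_apply_of_ne blk f hz)
      refine hN.trans ?_
      by_cases hsupp : ∃ x', blk x' = y₃ ∧ f x' ≠ 0
      · obtain ⟨x', hx'b, hx'f⟩ := hsupp
        obtain ⟨hnear, hlen⟩ := hfs x' hx'f
        rw [hx'b] at hnear hlen
        have hlenp : g.len y₃ ^ p ≤ ΛT ^ p * g.len y ^ p := by
          rw [← mul_pow]; exact pow_le_pow_left₀ (len_pos hL hge _).le hlen p
        have hnear' : g.dist y y₃ ≤ r₀ := by rw [hsym]; exact hnear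
        have hex : Real.exp (-(δ₀ * g.dist y₃ y'')) ≤ Real.exp (δ₀ * r₀) * E₀ := exp_near' htri hδ₀ hnear'
        have hsl3 := sl1_nonneg hη d (Set.indicator (blk ⁻¹' {y₃}) f)
        calc BG * g.len y₃ ^ p * Real.exp (-(δ₀ * g.dist y₃ y'')) * sl1 η d (Set.indicator (blk ⁻¹' {y₃}) f)
            ≤ BG * (ΛT ^ p * g.len y ^ p) * (Real.exp (δ₀ * r₀) * E₀) * sl1 η d (Set.indicator (blk ⁻¹' {y₃}) f) := by
              refine mul_le_mul_of_nonneg_right ?_ hsl3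
              exact mul_le_mul (mul_le_mul_of_nonneg_left hlenp hBG) hex (Real.exp_nonneg _)
                (mul_nonneg hBG (mul_nonneg (pow_nonneg hΛT p) (pow_nonneg hleny p)))
          _ = BG * ΛT ^ p * Real.exp (δ₀ * r₀) * g.len y ^ p * E₀ * sl1 η d (Set.indicator (blk ⁻¹' {y₃}) f) := by ring
      · push Not at hsupp
        have hz : Set.indicator (blk ⁻¹' {y₃}) f = 0 := piece_eq_zero blk fun z hz => hsupp z hz
        have hsl0 : sl1 η d (Set.indicator (blk ⁻¹' {y₃}) f) = 0 := by rw [hz, sl1]; simp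
        rw [hsl0, mul_zero, mul_zero]
    calc ∑ y₃ : g.Site, N y'' (Set.indicator (blk ⁻¹' {y₃}) f)
        ≤ ∑ y₃ : g.Site, BG * ΛT ^ p * Real.exp (δ₀ * r₀) * g.len y ^ p * E₀ * sl1 η d (Set.indicator (blk ⁻¹' {y₃}) f) :=
          Finset.sum_le_sum fun y₃ _ => hterm y₃
      _ = BG * ΛT ^ p * Real.exp (δ₀ * r₀) * g.len y ^ p * E₀ * sl1 η d f := by
          rw [← Finset.mul_sum, sl1_eq_sum_sl1On blk η d f]
          congr 1
          exact Finset.sum_congr rfl fun y₃ _ => sl1_piece blk η d y₃ f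
  -- (ii) G′Pλ: pieces of the spread function Pλ over all cubes, transfer (2.60) and the convolution (2.61)
  have h2 : N y'' (Pp f) ≤ BG * g.L ^ p * c * KP * Real.exp (δ₁ * r₀) * g.len y ^ p * E * sl1 η d f := by
    have hdec : N y'' (Pp f) ≤ ∑ y₄ : g.Site, N y'' (Set.indicator (blk ⁻¹' {y₄}) (Pp f)) := by
      conv_lhs => rw [← sum_piece blk (Pp f)]
      exact hNsum y'' Finset.univ (fun y₄ => Set.indicator (blk ⁻¹' {y₄}) (Pp f))
    refine hdec.trans ?_
    have hP4 : ∀ y₄ : g.Site, sl1 η d (Set.indicator (blk ⁻¹' {y₄}) (Pp f)) ≤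
        KP * Real.exp (δ₁ * r₀) * Real.exp (-(δ₁ * g.dist y₄ y)) * sl1 η d f := by
      intro y₄
      rw [sl1_piece]
      exact sl1On_P_le_near blk Pp hη d hv hvol hKP hδ₁ hPt htri (fun x hx => (hfs x hx).1) y₄
    have htr : ∀ y₄ : g.Site, g.len y₄ ^ p ≤ g.L ^ p * g.len y ^ p * Real.exp (α * δ₀ * g.dist y y₄) := fun y₄ =>
      B9SectDL2Decay.len_pow_le_of_ineq260 h260 hαδ hd hL hge.le p hRM y y₄
    have hterm : ∀ y₄ : g.Site, N y'' (Set.indicator (blk ⁻¹' {y₄}) (Pp f)) ≤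
        (BG * g.L ^ p * KP * Real.exp (δ₁ * r₀) * g.len y ^ p * sl1 η d f) *
          (Real.exp (-(δ₀ * g.dist y'' y₄)) * Real.exp (-(δL * g.dist y₄ y))) := by
      intro y₄
      have hN := hNd y₄ y'' (Set.indicator (blk ⁻¹' {y₄}) (Pp f)) (fun z hz => piece_apply_of_ne blk (Pp f) hz)
      refine hN.trans ?_
      have hA : BG * g.len y₄ ^ p * Real.exp (-(δ₀ * g.dist y₄ y'')) * sl1 η d (Set.indicator (blk ⁻¹' {y₄}) (Pp f)) ≤
          BG * (g.L ^ p * g.len y ^ p * Real.exp (α * δ₀ * g.dist y y₄)) * Real.exp (-(δ₀ * g.dist y₄ y'')) *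
            (KP * Real.exp (δ₁ * r₀) * Real.exp (-(δ₁ * g.dist y₄ y)) * sl1 η d f) := by
        refine mul_le_mul ?_ (hP4 y₄) (sl1_nonneg hη d _) ?_
        · exact mul_le_mul_of_nonneg_right (mul_le_mul_of_nonneg_left (htr y₄) hBG) (Real.exp_nonneg _)
        · exact mul_nonneg (mul_nonneg hBG (mul_nonneg (mul_nonneg (pow_nonneg hLnn p) (pow_nonneg hleny p))
            (Real.exp_nonneg _))) (Real.exp_nonneg _)
      refine hA.trans (le_of_eq ?_)
      have hexp : Real.exp (α * δ₀ * g.dist y y₄) * Real.exp (-(δ₁ * g.dist y₄ y)) = Real.exp (-(δL * g.dist y₄ y)) := by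
        rw [← Real.exp_add, hsym y y₄]; congr 1; rw [hδL]; ring
      rw [hsym y₄ y'', ← hexp]
      ring
    have hconv : ∑ y₄ : g.Site, Real.exp (-(δ₀ * g.dist y'' y₄)) * Real.exp (-(δL * g.dist y₄ y)) ≤ c * E := by
      have h := conv_exp_le (ρ₁ := δ₀) (ρ₂ := δL) (ρ := δL) htri hd hrow hδL0 le_rfl (by rw [hδL]; linarith) y'' y
      rw [hsym y'' y] at h
      exact h
    have hC0 : 0 ≤ BG * g.L ^ p * KP * Real.exp (δ₁ * r₀) * g.len y ^ p * sl1 η d f :=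
      mul_nonneg (mul_nonneg (mul_nonneg (mul_nonneg (mul_nonneg hBG (pow_nonneg hLnn p)) hKP) (Real.exp_nonneg _))
        (pow_nonneg hleny p)) hsl
    calc ∑ y₄ : g.Site, N y'' (Set.indicator (blk ⁻¹' {y₄}) (Pp f))
        ≤ ∑ y₄ : g.Site, (BG * g.L ^ p * KP * Real.exp (δ₁ * r₀) * g.len y ^ p * sl1 η d f) *
            (Real.exp (-(δ₀ * g.dist y'' y₄)) * Real.exp (-(δL * g.dist y₄ y))) := Finset.sum_le_sum fun y₄ _ => hterm y₄
      _ = (BG * g.L ^ p * KP * Real.exp (δ₁ * r₀) * g.len y ^ p * sl1 η d f) *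
            ∑ y₄ : g.Site, Real.exp (-(δ₀ * g.dist y'' y₄)) * Real.exp (-(δL * g.dist y₄ y)) := by rw [Finset.mul_sum]
      _ ≤ (BG * g.L ^ p * KP * Real.exp (δ₁ * r₀) * g.len y ^ p * sl1 η d f) * (c * E) :=
          mul_le_mul_of_nonneg_left hconv hC0
      _ = BG * g.L ^ p * c * KP * Real.exp (δ₁ * r₀) * g.len y ^ p * E * sl1 η d f := by ring
  -- (i) + (ii)
  have h1' : N y'' f ≤ BG * ΛT ^ p * Real.exp (δ₀ * r₀) * g.len y ^ p * E * sl1 η d f := by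
    refine h1.trans (mul_le_mul_of_nonneg_right (mul_le_mul_of_nonneg_left hE₀E ?_) hsl)
    exact mul_nonneg (mul_nonneg (mul_nonneg hBG (pow_nonneg hΛT p)) (Real.exp_nonneg _)) (pow_nonneg hleny p)
  refine (hNsub y'' f (Pp f)).trans ?_
  refine (add_le_add h1' h2).trans (le_of_eq ?_)
  ring

open Classical in
/-- **A block L¹ norm read on the unit translates** (print's `Δ̃(y)`): for a lattice translation `π = T_μ` moving every point to a cube
within distance `r₀` (`d(y_x, y_{πx}) ≦ r₀`), `‖F ∘ π‖_{L¹(Δ(y″))} ≦ Σ_{y⁗ : d(y″,y⁗) ≦ r₀} ‖F‖_{L¹(Δ(y⁗))}`.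
[cite: Balaban1985BackgroundPropagators, p.397 (Δ̃(y)), (3.131) p.422; Balaban1984PropagatorsII, (2.2) p.224] -/
theorem sl1On_comp_perm_le {η : ℝ} (hη : 0 ≤ η) (d : ℕ) (π : Equiv.Perm S) {r₀ : ℝ}
    (hnb : ∀ x, g.dist (blk x) (blk (π x)) ≤ r₀) (F : S → 𝔸) (y'' : g.Site) :
    sl1On blk η d y'' (F ∘ π) ≤ ∑ y₄ : g.Site, (if g.dist y'' y₄ ≤ r₀ then sl1On blk η d y₄ F else 0) := by
  have hηd : 0 ≤ η ^ d := pow_nonneg hη d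
  rw [sl1On_def]
  -- reindex the sum over Δ(y″) by z = πx
  have hre : ∑ x : S, (if blk x = y'' then ‖(F ∘ π) x‖ else 0) =
      ∑ z : S, (if blk (π.symm z) = y'' then ‖F z‖ else 0) := by
    rw [← Equiv.sum_comp π (fun z => if blk (π.symm z) = y'' then ‖F z‖ else 0)]
    refine Finset.sum_congr rfl fun x _ => ?_
    simp only [Function.comp_apply, Equiv.symm_apply_apply]
  rw [hre]
  -- every such z lies in a cube within r₀ of Δ(y″)
  have hpt : ∀ z : S, (if blk (π.symm z) = y'' then ‖F z‖ else 0) ≤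
      (if g.dist y'' (blk z) ≤ r₀ then ‖F z‖ else 0) := by
    intro z
    by_cases hz : blk (π.symm z) = y''
    · have hnear : g.dist y'' (blk z) ≤ r₀ := by
        have h := hnb (π.symm z)
        rw [Equiv.apply_symm_apply, hz] at h
        exact h
      rw [if_pos hz, if_pos hnear]
    · rw [if_neg hz]; split_ifs <;> simp
  have hsplit : ∑ z : S, (if g.dist y'' (blk z) ≤ r₀ then ‖F z‖ else 0) =
      ∑ y₄ : g.Site, (if g.dist y'' y₄ ≤ r₀ then ∑ z : S, (if blk z = y₄ then ‖F z‖ else 0) else 0) := by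
    rw [sum_eq_sum_blocks blk (fun z => if g.dist y'' (blk z) ≤ r₀ then ‖F z‖ else 0)]
    refine Finset.sum_congr rfl fun y₄ _ => ?_
    split_ifs with h4
    · refine Finset.sum_congr rfl fun z _ => ?_
      by_cases hz : blk z = y₄
      · rw [if_pos hz, if_pos hz, hz, if_pos h4]
      · rw [if_neg hz, if_neg hz]
    · refine Finset.sum_eq_zero fun z _ => ?_
      by_cases hz : blk z = y₄
      · rw [if_pos hz, hz, if_neg h4]
      · rw [if_neg hz]
  calc η ^ d * ∑ z : S, (if blk (π.symm z) = y'' then ‖F z‖ else 0)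
      ≤ η ^ d * ∑ z : S, (if g.dist y'' (blk z) ≤ r₀ then ‖F z‖ else 0) :=
        mul_le_mul_of_nonneg_left (Finset.sum_le_sum fun z _ => hpt z) hηd
    _ = ∑ y₄ : g.Site, (if g.dist y'' y₄ ≤ r₀ then sl1On blk η d y₄ F else 0) := by
        rw [hsplit, Finset.mul_sum]
        refine Finset.sum_congr rfl fun y₄ _ => ?_
        split_ifs
        · rw [sl1On_def]
        · rw [mul_zero]

open Classical in
/-- **Summing a decaying block bound over the cubes near `Δ(y″)`**: if `a(y⁗) ≦ C·e^{−δd(y,y⁗)}` for all `y⁗` then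
`Σ_{y⁗ : d(y″,y⁗) ≦ r₀} a(y⁗) ≦ C·ce^{σr₀}e^{δr₀}·e^{−δd(y,y″)}` (`δ, σ ≧ 0`, `C ≧ 0`).
[cite: Balaban1984PropagatorsII, (2.54) p.233, Lemma 2.1 (2.61) p.234] -/
theorem sum_near_le (hsym : DistSymm g) (htri : Triangle254 g) {σ c : ℝ} (hrow : RowSum g σ c) (hσ : 0 ≤ σ)
    {δ C r₀ : ℝ} (hδ : 0 ≤ δ) (hC : 0 ≤ C) {a : g.Site → ℝ} {y y'' : g.Site}
    (ha : ∀ y₄, a y₄ ≤ C * Real.exp (-(δ * g.dist y y₄))) :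
    ∑ y₄ : g.Site, (if g.dist y'' y₄ ≤ r₀ then a y₄ else 0) ≤
      C * (c * Real.exp (σ * r₀)) * Real.exp (δ * r₀) * Real.exp (-(δ * g.dist y y'')) := by
  set E : ℝ := Real.exp (-(δ * g.dist y y'')) with hE
  have hterm : ∀ y₄ : g.Site, (if g.dist y'' y₄ ≤ r₀ then a y₄ else 0) ≤
      (if g.dist y₄ y'' ≤ r₀ then (1 : ℝ) else 0) * (C * Real.exp (δ * r₀) * E) := by
    intro y₄
    by_cases h4 : g.dist y'' y₄ ≤ r₀
    · have h4' : g.dist y₄ y'' ≤ r₀ := by rw [hsym]; exact h4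
      rw [if_pos h4, if_pos h4', one_mul]
      refine (ha y₄).trans ?_
      have hex : Real.exp (-(δ * g.dist y y₄)) ≤ Real.exp (δ * r₀) * E := exp_near htri hδ h4'
      have := mul_le_mul_of_nonneg_left hex hC
      rw [← mul_assoc] at this
      exact this
    · rw [if_neg h4]
      split_ifs
      · rw [one_mul]; exact mul_nonneg (mul_nonneg hC (Real.exp_nonneg _)) (Real.exp_nonneg _)
      · rw [zero_mul]
  calc ∑ y₄ : g.Site, (if g.dist y'' y₄ ≤ r₀ then a y₄ else 0)
      ≤ ∑ y₄ : g.Site, (if g.dist y₄ y'' ≤ r₀ then (1 : ℝ) else 0) * (C * Real.exp (δ * r₀) * E) :=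
        Finset.sum_le_sum fun y₄ _ => hterm y₄
    _ = (∑ y₄ : g.Site, (if g.dist y₄ y'' ≤ r₀ then (1 : ℝ) else 0)) * (C * Real.exp (δ * r₀) * E) := by
        rw [Finset.sum_mul]
    _ ≤ (c * Real.exp (σ * r₀)) * (C * Real.exp (δ * r₀) * E) :=
        mul_le_mul_of_nonneg_right (count_near_le hsym hrow hσ r₀ y'')
          (mul_nonneg (mul_nonneg hC (Real.exp_nonneg _)) (Real.exp_nonneg _))
    _ = C * (c * Real.exp (σ * r₀)) * Real.exp (δ * r₀) * E := by ring

end L1Entries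


section L1EntriesLattice

variable {𝔸 : Type*} [NormedRing 𝔸] [NormedAlgebra ℂ 𝔸]
variable {S : Type*} [Fintype S] {ι : Type*} [Fintype ι]
variable (T : ι → Equiv.Perm S) (U : ι → S → 𝔸ˣ)
variable {g : B6.Geometry} (blk : S → g.Site)

omit [NormedAlgebra ℂ 𝔸] [Fintype ι] in
open Classical in
/-- **L¹ entry `‖G′Rλ‖_{L¹(Δ(y″))}`** (the `hL0` input of `B9Ineq3131Assembly.ineq3131_assembled`): from the L¹ dual of (3.42)₁ for the
symmetric `G′` (`‖G′λ‖_{L¹(Δ(y″))} ≦ B_G(Lʲη)²e^{−δ₀d(y,y″)}‖λ‖_{L¹}`, `supp λ ⊂ Δ(y)`), the (3.49)₁ letter in the row-volume reading, the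
p. 398 transfer (2.60) with `2 log L ≦ αδ₀RM`, rates `αδ₀ ≦ δ₁`, `δ₁ − αδ₀ + σ ≦ δ₀`, and `supp λ` within `r₀` of `Δ(y)` in cubes of
size `≦ Λ_T·Lʲη`: `‖G′(λ − Pλ)‖_{L¹(Δ(y″))} ≦ C_L(Lʲη)²e^{−(δ₁−αδ₀)d(y,y″)}‖λ‖_{L¹}`, `C_L = B_G(Λ_T²e^{δ₀r₀} + L²cK_Pe^{δ₁r₀})`.
[cite: Balaban1985BackgroundPropagators, (3.42) p.397, p.398, (3.49) p.399, (3.131) p.422; Balaban1984PropagatorsII, Lemma 2.1 (2.60)–(2.61) p.234] -/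
theorem l1_entry0 (Gp Pp : (S → 𝔸) →+ (S → 𝔸)) {BG δ₀ δ₁ α : ℝ} (hBG : 0 ≤ BG) (hδ₁ : 0 ≤ δ₁) {η : ℝ} (hη : 0 ≤ η) (d : ℕ)
    (hG0d : ∀ (y y'' : g.Site) (f : S → 𝔸), (∀ x, blk x ≠ y → f x = 0) →
      sl1On blk η d y'' (Gp f) ≤ BG * g.len y ^ 2 * Real.exp (-(δ₀ * g.dist y y'')) * sl1 η d f)
    {v : g.Site → ℝ} (hv : ∀ y, 0 < v y)
    (hvol : ∀ y : g.Site, η ^ d * ∑ x : S, (if blk x = y then (1 : ℝ) else 0) ≤ v y)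
    {KP : ℝ} (hKP : 0 ≤ KP)
    (hPt : ∀ (f : S → 𝔸) (z : S), ‖Pp f z‖ ≤
      ∑ x' : S, η ^ d * (KP * Real.exp (-(δ₁ * g.dist (blk z) (blk x'))) * (v (blk z))⁻¹) * ‖f x'‖)
    (hd : ∀ a b : g.Site, 0 ≤ g.dist a b) (hsym : DistSymm g) (htri : Triangle254 g) {σ c : ℝ} (hrow : RowSum g σ c)
    (hσ : 0 ≤ σ) (h260 : Ineq260 g δ₀ α) (hαδ : 0 ≤ α * δ₀) (hαδ₁ : α * δ₀ ≤ δ₁) (hδ : δ₁ - α * δ₀ + σ ≤ δ₀)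
    (hL : 1 ≤ g.L) (hge : 0 < g.eta) (hRM : 2 * Real.log g.L ≤ α * δ₀ * g.R * g.M)
    {r₀ ΛT : ℝ} (hΛT : 0 ≤ ΛT) {f : S → 𝔸} {y : g.Site}
    (hfs : ∀ x, f x ≠ 0 → g.dist (blk x) y ≤ r₀ ∧ g.len (blk x) ≤ ΛT * g.len y) (y'' : g.Site) :
    sl1On blk η d y'' (Gp (f - Pp f)) ≤ BG * (ΛT ^ 2 * Real.exp (δ₀ * r₀) + g.L ^ 2 * c * KP * Real.exp (δ₁ * r₀)) *
      g.len y ^ 2 * Real.exp (-((δ₁ - α * δ₀) * g.dist y y'')) * sl1 η d f := by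
  have hRM2 : ((2 : ℕ) : ℝ) * Real.log g.L ≤ α * δ₀ * g.R * g.M := by push_cast; exact hRM
  have h := l1_entry blk (fun y'' h => sl1On blk η d y'' (Gp h)) Pp
    (fun y'' f h => by simp only [map_sub]; exact sl1On_sub_le blk hη d y'' _ _)
    (fun y'' s F => by simp only [map_sum]; exact sl1On_sum_le blk hη d y'' s _)
    2 hBG hδ₁ hη d hG0d hv hvol hKP hPt hd hsym htri hrow hσ h260 hαδ hαδ₁ hδ hL hge hRM2 hΛT hfs y''
  exact h

omit [NormedAlgebra ℂ 𝔸] [Fintype ι] in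
open Classical in
/-- **L¹ entry on the unit translates `‖(G′Rλ)(· + e_μ)‖_{L¹(Δ(y″))}`** (the `hL0s` input; print's `Δ̃(y″)`): under the block-map
geometry `d(y_x, y_{x+e_μ}) ≦ r₀`, the L¹ entry summed over the cubes within `r₀` of `Δ(y″)`:
`≦ C_L·ce^{σr₀}e^{(δ₁−αδ₀)r₀}·(Lʲη)²e^{−(δ₁−αδ₀)d(y,y″)}‖λ‖_{L¹}`.
[cite: Balaban1985BackgroundPropagators, p.397 (Δ̃(y)), (3.49) p.399, (3.131) p.422; Balaban1984PropagatorsII, (2.2) p.224, Lemma 2.1 p.234] -/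
theorem l1_entry0_shift (Gp Pp : (S → 𝔸) →+ (S → 𝔸)) {BG δ₀ δ₁ α : ℝ} (hBG : 0 ≤ BG) (hδ₁ : 0 ≤ δ₁) {η : ℝ} (hη : 0 ≤ η)
    (d : ℕ)
    (hG0d : ∀ (y y'' : g.Site) (f : S → 𝔸), (∀ x, blk x ≠ y → f x = 0) →
      sl1On blk η d y'' (Gp f) ≤ BG * g.len y ^ 2 * Real.exp (-(δ₀ * g.dist y y'')) * sl1 η d f)
    {v : g.Site → ℝ} (hv : ∀ y, 0 < v y)
    (hvol : ∀ y : g.Site, η ^ d * ∑ x : S, (if blk x = y then (1 : ℝ) else 0) ≤ v y)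
    {KP : ℝ} (hKP : 0 ≤ KP)
    (hPt : ∀ (f : S → 𝔸) (z : S), ‖Pp f z‖ ≤
      ∑ x' : S, η ^ d * (KP * Real.exp (-(δ₁ * g.dist (blk z) (blk x'))) * (v (blk z))⁻¹) * ‖f x'‖)
    (hd : ∀ a b : g.Site, 0 ≤ g.dist a b) (hsym : DistSymm g) (htri : Triangle254 g) {σ c : ℝ} (hrow : RowSum g σ c)
    (hσ : 0 ≤ σ) (h260 : Ineq260 g δ₀ α) (hαδ : 0 ≤ α * δ₀) (hαδ₁ : α * δ₀ ≤ δ₁) (hδ : δ₁ - α * δ₀ + σ ≤ δ₀)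
    (hL : 1 ≤ g.L) (hge : 0 < g.eta) (hRM : 2 * Real.log g.L ≤ α * δ₀ * g.R * g.M)
    {r₀ ΛT : ℝ} (hΛT : 0 ≤ ΛT) (hnb : ∀ μ x, g.dist (blk x) (blk (T μ x)) ≤ r₀) {f : S → 𝔸} {y : g.Site}
    (hfs : ∀ x, f x ≠ 0 → g.dist (blk x) y ≤ r₀ ∧ g.len (blk x) ≤ ΛT * g.len y) (y'' : g.Site) (μ : ι) :
    sl1On blk η d y'' (Gp (f - Pp f) ∘ (T μ)) ≤
      BG * (ΛT ^ 2 * Real.exp (δ₀ * r₀) + g.L ^ 2 * c * KP * Real.exp (δ₁ * r₀)) * (c * Real.exp (σ * r₀)) *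
        Real.exp ((δ₁ - α * δ₀) * r₀) * g.len y ^ 2 * Real.exp (-((δ₁ - α * δ₀) * g.dist y y'')) * sl1 η d f := by
  have hc : 0 ≤ c := hrow.nonneg y
  have h1 := sl1On_comp_perm_le blk hη d (T μ) (hnb μ) (Gp (f - Pp f)) y''
  refine h1.trans ?_
  have hC : 0 ≤ BG * (ΛT ^ 2 * Real.exp (δ₀ * r₀) + g.L ^ 2 * c * KP * Real.exp (δ₁ * r₀)) * g.len y ^ 2 * sl1 η d f :=
    mul_nonneg (mul_nonneg (mul_nonneg hBG (add_nonneg (mul_nonneg (pow_two_nonneg _) (Real.exp_nonneg _))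
      (mul_nonneg (mul_nonneg (mul_nonneg (pow_two_nonneg _) hc) hKP) (Real.exp_nonneg _)))) (pow_two_nonneg _))
      (sl1_nonneg hη d f)
  have ha : ∀ y₄ : g.Site, sl1On blk η d y₄ (Gp (f - Pp f)) ≤
      (BG * (ΛT ^ 2 * Real.exp (δ₀ * r₀) + g.L ^ 2 * c * KP * Real.exp (δ₁ * r₀)) * g.len y ^ 2 * sl1 η d f) *
        Real.exp (-((δ₁ - α * δ₀) * g.dist y y₄)) := by
    intro y₄
    have h := l1_entry0 blk Gp Pp hBG hδ₁ hη d hG0d hv hvol hKP hPt hd hsym htri hrow hσ h260 hαδ hαδ₁ hδ hL hge hRM hΛT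
      hfs y₄
    refine h.trans (le_of_eq ?_)
    ring
  have h2 := sum_near_le hsym htri hrow hσ (δ := δ₁ - α * δ₀) (r₀ := r₀) (y'' := y'') (by linarith) hC ha
  refine h2.trans (le_of_eq ?_)
  ring

open Classical in
/-- **L¹ entry `‖∇_UG′Rλ‖_{L¹(Δ(y″))}`** (the `hL1` input): from the L¹ dual of (3.42)₃ for the symmetric `G′`
(`‖D^η_UG′λ‖_{L¹(Δ(y″))} ≦ B_G(Lʲη)e^{−δ₀d(y,y″)}‖λ‖_{L¹}`, `supp λ ⊂ Δ(y)`), the (3.49)₁ letter in the row-volume reading, the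
p. 398 transfer with `2 log L ≦ αδ₀RM`, and `supp λ` within `r₀` of `Δ(y)` in cubes of size `≦ Λ_T·Lʲη`:
`‖D^η_UG′(λ − Pλ)‖_{L¹(Δ(y″))} ≦ B_G(Λ_Te^{δ₀r₀} + LcK_Pe^{δ₁r₀})(Lʲη)e^{−(δ₁−αδ₀)d(y,y″)}‖λ‖_{L¹}`.
[cite: Balaban1985BackgroundPropagators, (3.42) p.397, (3.3) p.391, p.398, (3.49) p.399, (3.131) p.422; Balaban1984PropagatorsII, Lemma 2.1 (2.60)–(2.61) p.234] -/
theorem l1_entry1 (Gp Pp : (S → 𝔸) →+ (S → 𝔸)) {BG δ₀ δ₁ α : ℝ} (hBG : 0 ≤ BG) (hδ₁ : 0 ≤ δ₁) (η : ℝ) (hη : 0 ≤ η) (d : ℕ)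
    (hG1d : ∀ (y y'' : g.Site) (f : S → 𝔸), (∀ x, blk x ≠ y → f x = 0) →
      bl1On blk η d y'' (covDη T U η (Gp f)) ≤ BG * g.len y * Real.exp (-(δ₀ * g.dist y y'')) * sl1 η d f)
    {v : g.Site → ℝ} (hv : ∀ y, 0 < v y)
    (hvol : ∀ y : g.Site, η ^ d * ∑ x : S, (if blk x = y then (1 : ℝ) else 0) ≤ v y)
    {KP : ℝ} (hKP : 0 ≤ KP)
    (hPt : ∀ (f : S → 𝔸) (z : S), ‖Pp f z‖ ≤
      ∑ x' : S, η ^ d * (KP * Real.exp (-(δ₁ * g.dist (blk z) (blk x'))) * (v (blk z))⁻¹) * ‖f x'‖)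
    (hd : ∀ a b : g.Site, 0 ≤ g.dist a b) (hsym : DistSymm g) (htri : Triangle254 g) {σ c : ℝ} (hrow : RowSum g σ c)
    (hσ : 0 ≤ σ) (h260 : Ineq260 g δ₀ α) (hαδ : 0 ≤ α * δ₀) (hαδ₁ : α * δ₀ ≤ δ₁) (hδ : δ₁ - α * δ₀ + σ ≤ δ₀)
    (hL : 1 ≤ g.L) (hge : 0 < g.eta) (hRM : 2 * Real.log g.L ≤ α * δ₀ * g.R * g.M)
    {r₀ ΛT : ℝ} (hΛT : 0 ≤ ΛT) {f : S → 𝔸} {y : g.Site}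
    (hfs : ∀ x, f x ≠ 0 → g.dist (blk x) y ≤ r₀ ∧ g.len (blk x) ≤ ΛT * g.len y) (y'' : g.Site) :
    bl1On blk η d y'' (covDη T U η (Gp (f - Pp f))) ≤ BG * (ΛT ^ 1 * Real.exp (δ₀ * r₀) + g.L ^ 1 * c * KP * Real.exp (δ₁ * r₀)) *
      g.len y ^ 1 * Real.exp (-((δ₁ - α * δ₀) * g.dist y y'')) * sl1 η d f := by
  have hRM1 : ((1 : ℕ) : ℝ) * Real.log g.L ≤ α * δ₀ * g.R * g.M := by
    have hlog : 0 ≤ Real.log g.L := Real.log_nonneg hL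
    push_cast; linarith
  have hsubD : ∀ a b : S → 𝔸, covDη T U η (a - b) = covDη T U η a - covDη T U η b := fun a b => by
    funext μ x; rw [Pi.sub_apply, Pi.sub_apply]; exact covDη_sub T U η a b μ x
  have hsumD : ∀ (s : Finset g.Site) (F : g.Site → S → 𝔸),
      covDη T U η (∑ w ∈ s, F w) = ∑ w ∈ s, covDη T U η (F w) := fun s F => by
    funext μ x; rw [Finset.sum_apply, Finset.sum_apply]; exact covDη_sum T U η s F μ x
  have hG1d' : ∀ (y y'' : g.Site) (f : S → 𝔸), (∀ x, blk x ≠ y → f x = 0) →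
      bl1On blk η d y'' (covDη T U η (Gp f)) ≤ BG * g.len y ^ 1 * Real.exp (-(δ₀ * g.dist y y'')) * sl1 η d f := by
    simpa only [pow_one] using hG1d
  have h := l1_entry blk (fun y'' h => bl1On blk η d y'' (covDη T U η (Gp h))) Pp
    (fun y'' f h => by simp only [map_sub, hsubD]; exact bl1On_sub_le blk hη d y'' _ _)
    (fun y'' s F => by simp only [map_sum, hsumD]; exact bl1On_sum_le blk hη d y'' s _)
    1 hBG hδ₁ hη d hG1d' hv hvol hKP hPt hd hsym htri hrow hσ h260 hαδ hαδ₁ hδ hL hge hRM1 hΛT hfs y''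
  exact h

end L1EntriesLattice

/-! ## §7 `λ = D*A` for `A` supported in one cube, and (3.131) FROM THE LETTERS -/

section Assembly

variable {𝔸 : Type*} [NormedRing 𝔸] [NormedAlgebra ℂ 𝔸]
variable {S : Type*} [Fintype S] {ι : Type*} [Fintype ι] [LinearOrder ι]
variable (T : ι → Equiv.Perm S) (U : ι → S → 𝔸ˣ)
variable {g : B6.Geometry} (blk : S → g.Site)

omit [Fintype S] [LinearOrder ι] in
/-- **`supp D*A` for `supp A ⊂ Δ(y)`** under the block-map geometry: every point where `D^{η*}_UA ≠ 0` lies in a cube within `r₀` of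
`Δ(y)` (`d(y,y) = 0 ≦ r₀`) whose size is `≦ Λ_T·Lʲη` (`Λ_T ≧ 1`; neighbouring cubes differ by at most one level, (2.2) of [4]).
[cite: Balaban1985BackgroundPropagators, (3.8) p.392, p.397 (Δ̃(y)); Balaban1984PropagatorsII, (2.2) p.224] -/
theorem divBη_support (η : ℝ) (hrefl : ∀ a : g.Site, g.dist a a = 0) (hsym : DistSymm g) (hL : 1 ≤ g.L) (hge : 0 < g.eta)
    {r₀ ΛT : ℝ} (hr₀ : 0 ≤ r₀) (hΛT : 1 ≤ ΛT) (hnb : ∀ μ x, g.dist (blk x) (blk (T μ x)) ≤ r₀)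
    (hnbl : ∀ μ x, g.len (blk (T μ x)) ≤ ΛT * g.len (blk x))
    {A : ι → S → 𝔸} {y : g.Site} (hA : ∀ μ x, blk x ≠ y → A μ x = 0) (x : S) (hx : divBη T U η A x ≠ 0) :
    g.dist (blk x) y ≤ r₀ ∧ g.len (blk x) ≤ ΛT * g.len y := by
  by_cases hxy : blk x = y
  · rw [hxy, hrefl]
    exact ⟨hr₀, le_mul_of_one_le_left (len_pos hL hge y).le hΛT⟩
  · by_contra hcon
    apply hx
    refine divBη_eq_zero_of_far T U blk η hA hxy fun μ hμ => hcon ?_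
    have h1 := hnb μ ((T μ).symm x)
    have h2 := hnbl μ ((T μ).symm x)
    rw [Equiv.apply_symm_apply, hμ] at h1 h2
    rw [hsym] at h1
    exact ⟨h1, h2⟩

open Classical in
/-- **(3.131) FROM THEOREM 3.1 AND (3.49)** (p. 421–422: *"It is easy to find estimates for the operator Δ′_π, using Theorem 3.1 and the
inequality (3.49) … We have |⟨A₁Δ′_πA₂⟩| ≦ O(1)Mα₀(‖D*A₁‖_{L¹} + (Lʲη)^{−1}‖A₁‖_{L¹})e^{−(1/2)δ₀d(y,y′)}(|D*A₂| + (L^{j′}η)^{−1}|A₂|) for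
supp A₁ ⊂ Δ(y), y ∈ Λ_j, supp A₂ ⊂ Δ(y′), y′ ∈ Λ_{j′}. (3.131)"*).  For PRINT'S OWN `𝒫A = G′(U)R(U)D*_UA`, `R = I − P` — i.e. the map
`A ↦ G′(D*A − P D*A)` built from the letters `G′`, `P` and the η-divergence `D^{η*}_U` of (3.8) — the six composite inputs `hS0/hS0s/hS1/
hL0/hL0s/hL1` of `B9Ineq3131Assembly.ineq3131_assembled` ARE DERIVED (§§5–6) from: THEOREM 3.1 (3.42)₁,₂ for `G′(U)` as block majorants
(`hG0`, `hG1`) and the L¹ duals of (3.42)₁,₃ for the symmetric `G′` (`hG0d`, `hG1d`); (3.49)₁ for `P(U)` in the printed kernel form, column-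
and row-volume readings (`hP`, `hPt`; the latter = (3.49)₁ by the symmetry of `P`, p. 394); the block-map geometry of `Δ̃` (p. 397, [4] (2.2):
unit translates move cubes by `≦ r₀`, sizes by `≦ Λ_T`; block volumes `η^d#Δ(y) ≦ v(y)`; p. 397); [4]: `d ≧ 0` symmetric with `d(y,y) = 0` and
(2.54), the row sum (2.61) at rate `σ`, (2.60) at rate `αδ₀` with `2 log L ≦ αδ₀RM`; rates `δ₁ + σ ≦ δ₀`, `αδ₀ ≦ δ₁` (`δ₁` = the rate of
(3.49), printed `½δ₀`).  CONCLUSION = `ineq3131_assembled`'s, at `δ_P = δ₁ − αδ₀` and with the printed norms `m₁ = ‖D*A₁‖_{L¹}`,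
`n₂ = |D*A₂|`, `|A₂| = bsup A₂`: for every `ρ ≧ 0` with `ρ + σ + αδ₀ ≦ δ₁ − αδ₀`,
`|⟨A₁,Δ′_πA₂⟩| ≦ O₁·Mα₀·(‖D*A₁‖_{L¹} + (Lʲη)^{−1}‖A₁‖_{L¹})·e^{−ρd(y,y′)}·(|D*A₂| + (L^{j′}η)^{−1}|A₂|)` with `O₁ = O1 ‖τ‖ c_J C_P |ι| L c`
and the EXPLICIT `C_P` below (the sum of the six entry constants).  Rate accounting (cell GAPS G-B9-r06-2): with the printed `δ₁ = ½δ₀` the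
honest `ρ` is `½δ₀ − 2αδ₀ − σ`; print's `½δ₀` in (3.131) is its generic-constant convention for `δ₀` (pp. 423–424).
[cite: Balaban1985BackgroundPropagators, (3.131) p.422, p.421, (3.42) p.397, p.397 (Δ̃(y)), (3.49) p.399, (3.8) p.392; Balaban1984PropagatorsII, (2.2) p.224, (2.54) p.233, Lemma 2.1 (2.60)–(2.61) p.234] -/
theorem ineq3131_letters
    (hU : ∀ μ x, ‖(U μ x : 𝔸)‖ ≤ 1 ∧ ‖(((U μ x)⁻¹ : 𝔸ˣ) : 𝔸)‖ ≤ 1) (τ : 𝔸 →L[ℂ] ℂ) {η : ℝ} (hη : 0 < η) (d : ℕ)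
    (Gp Pp : (S → 𝔸) →+ (S → 𝔸)) (A₁ A₂ : ι → S → 𝔸) (y y' : g.Site)
    -- the geometry of [4]
    (hd : ∀ a b : g.Site, 0 ≤ g.dist a b) (hrefl : ∀ a : g.Site, g.dist a a = 0) (hsym : DistSymm g) (htri : Triangle254 g)
    {σ c δ₀ α δ₁ : ℝ} (hrow : RowSum g σ c) (h260 : Ineq260 g δ₀ α) (hαδ : 0 ≤ α * δ₀) (hσ : 0 ≤ σ)
    (hL : 1 ≤ g.L) (hge : 0 < g.eta) (hRM : 2 * Real.log g.L ≤ α * δ₀ * g.R * g.M)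
    (hδ₁σ : δ₁ + σ ≤ δ₀) (hαδ₁ : α * δ₀ ≤ δ₁)
    -- the block-map geometry of Δ̃ and the block volumes
    {r₀ ΛT : ℝ} (hr₀ : 0 ≤ r₀) (hΛT : 1 ≤ ΛT) (hnb : ∀ μ x, g.dist (blk x) (blk (T μ x)) ≤ r₀)
    (hnbl : ∀ μ x, g.len (blk (T μ x)) ≤ ΛT * g.len (blk x))
    {v : g.Site → ℝ} (hv : ∀ y, 0 < v y) (hvol : ∀ y : g.Site, η ^ d * ∑ x : S, (if blk x = y then (1 : ℝ) else 0) ≤ v y)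
    -- THEOREM 3.1 for G′(U): (3.42)₁,₂ as block majorants, and the L¹ duals of (3.42)₁,₃ (G′ symmetric)
    {BG : ℝ} (hBG : 0 ≤ BG)
    (hG0 : ∀ (y'' : g.Site) (f : S → 𝔸) (B : ℝ), 0 ≤ B → (∀ x, blk x = y'' → ‖f x‖ ≤ B) → (∀ x, blk x ≠ y'' → f x = 0) →
      ∀ x, ‖Gp f x‖ ≤ BG * g.len (blk x) ^ 2 * Real.exp (-(δ₀ * g.dist (blk x) y'')) * B)
    (hG1 : ∀ (y'' : g.Site) (f : S → 𝔸) (B : ℝ), 0 ≤ B → (∀ x, blk x = y'' → ‖f x‖ ≤ B) → (∀ x, blk x ≠ y'' → f x = 0) →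
      ∀ μ x, ‖covDη T U η (Gp f) μ x‖ ≤ BG * g.len (blk x) * Real.exp (-(δ₀ * g.dist (blk x) y'')) * B)
    (hG0d : ∀ (y y'' : g.Site) (f : S → 𝔸), (∀ x, blk x ≠ y → f x = 0) →
      sl1On blk η d y'' (Gp f) ≤ BG * g.len y ^ 2 * Real.exp (-(δ₀ * g.dist y y'')) * sl1 η d f)
    (hG1d : ∀ (y y'' : g.Site) (f : S → 𝔸), (∀ x, blk x ≠ y → f x = 0) →
      bl1On blk η d y'' (covDη T U η (Gp f)) ≤ BG * g.len y * Real.exp (-(δ₀ * g.dist y y'')) * sl1 η d f)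
    -- (3.49)₁ for P(U): the printed kernel bound, column- and row-volume readings (P symmetric)
    {KP : ℝ} (hKP : 0 ≤ KP)
    (hP : ∀ (f : S → 𝔸) (z : S), ‖Pp f z‖ ≤
      ∑ x' : S, η ^ d * (KP * Real.exp (-(δ₁ * g.dist (blk z) (blk x'))) * (v (blk x'))⁻¹) * ‖f x'‖)
    (hPt : ∀ (f : S → 𝔸) (z : S), ‖Pp f z‖ ≤
      ∑ x' : S, η ^ d * (KP * Real.exp (-(δ₁ * g.dist (blk z) (blk x'))) * (v (blk z))⁻¹) * ‖f x'‖)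
    -- the bond functions and the current
    (hA₁ : ∀ μ x, blk x ≠ y → A₁ μ x = 0) (hA₂ : ∀ μ x, blk x ≠ y' → A₂ μ x = 0)
    {cJ Ma : ℝ} (hcJ : 0 ≤ cJ) (hMa : 0 ≤ Ma)
    (hJ : ∀ μ x, ‖B9Eq39Adjoint.J T U η μ x‖ ≤ cJ * Ma * (g.len (blk x) ^ 3)⁻¹)
    {ρ : ℝ} (hρ : 0 ≤ ρ) (hρP : ρ + σ + α * δ₀ ≤ δ₁ - α * δ₀) :
    ‖B9Eq3131Pointwise.deltaPiPrimeBil T U η d (τ : 𝔸 →ₗ[ℂ] ℂ)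
        (fun A => Gp (divBη T U η A - Pp (divBη T U η A))) A₁ A₂‖ ≤
      O1 ‖τ‖ cJ
        (c * Real.exp (σ * r₀) * (Real.exp (δ₀ * r₀) + c * KP * Real.exp (δ₁ * r₀)) * BG * (2 + ΛT ^ 2 * Real.exp (δ₁ * r₀))
          + BG * (ΛT ^ 2 * Real.exp (δ₀ * r₀) + g.L ^ 2 * c * KP * Real.exp (δ₁ * r₀)) *
              (1 + c * Real.exp (σ * r₀) * Real.exp ((δ₁ - α * δ₀) * r₀))
          + BG * (ΛT * Real.exp (δ₀ * r₀) + g.L * c * KP * Real.exp (δ₁ * r₀)))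
        (Fintype.card ι) g.L c * Ma * (sl1 η d (divBη T U η A₁) + (g.len y)⁻¹ * bl1 η d A₁)
        * Real.exp (-(ρ * g.dist y y')) * (ssup (divBη T U η A₂) + (g.len y')⁻¹ * bsup A₂) := by
  -- abbreviations for the three entry constants
  set CS : ℝ := c * Real.exp (σ * r₀) * (Real.exp (δ₀ * r₀) + c * KP * Real.exp (δ₁ * r₀)) * BG with hCS
  set CL2 : ℝ := BG * (ΛT ^ 2 * Real.exp (δ₀ * r₀) + g.L ^ 2 * c * KP * Real.exp (δ₁ * r₀)) with hCL2
  set CL1 : ℝ := BG * (ΛT * Real.exp (δ₀ * r₀) + g.L * c * KP * Real.exp (δ₁ * r₀)) with hCL1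
  set Ks : ℝ := c * Real.exp (σ * r₀) * Real.exp ((δ₁ - α * δ₀) * r₀) with hKs
  set CP : ℝ := CS * (2 + ΛT ^ 2 * Real.exp (δ₁ * r₀)) + CL2 * (1 + Ks) + CL1 with hCP
  have hc : 0 ≤ c := hrow.nonneg y
  have hLnn : 0 ≤ g.L := zero_le_one.trans hL
  have hΛT0 : 0 ≤ ΛT := zero_le_one.trans hΛT
  have hδ₁ : 0 ≤ δ₁ := hαδ.trans hαδ₁
  have hδL : δ₁ - α * δ₀ + σ ≤ δ₀ := by linarith
  have hCS0 : 0 ≤ CS := mul_nonneg (mul_nonneg (mul_nonneg hc (Real.exp_nonneg _))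
    (add_nonneg (Real.exp_nonneg _) (mul_nonneg (mul_nonneg hc hKP) (Real.exp_nonneg _)))) hBG
  have hCL20 : 0 ≤ CL2 := mul_nonneg hBG (add_nonneg (mul_nonneg (pow_nonneg hΛT0 2) (Real.exp_nonneg _))
    (mul_nonneg (mul_nonneg (mul_nonneg (pow_nonneg hLnn 2) hc) hKP) (Real.exp_nonneg _)))
  have hCL10 : 0 ≤ CL1 := mul_nonneg hBG (add_nonneg (mul_nonneg hΛT0 (Real.exp_nonneg _))
    (mul_nonneg (mul_nonneg (mul_nonneg hLnn hc) hKP) (Real.exp_nonneg _)))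
  have hKs0 : 0 ≤ Ks := mul_nonneg (mul_nonneg hc (Real.exp_nonneg _)) (Real.exp_nonneg _)
  have hE1 : 0 ≤ ΛT ^ 2 * Real.exp (δ₁ * r₀) := mul_nonneg (pow_nonneg hΛT0 2) (Real.exp_nonneg _)
  have hCP0 : 0 ≤ CP :=
    add_nonneg (add_nonneg (mul_nonneg hCS0 (add_nonneg zero_le_two hE1)) (mul_nonneg hCL20 (add_nonneg zero_le_one hKs0))) hCL10
  -- each entry constant is ≦ C_P
  have hp1 : 0 ≤ CS * (ΛT ^ 2 * Real.exp (δ₁ * r₀)) := mul_nonneg hCS0 hE1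
  have hp2 : 0 ≤ CL2 * Ks := mul_nonneg hCL20 hKs0
  have hCPe : CP = 2 * CS + CS * (ΛT ^ 2 * Real.exp (δ₁ * r₀)) + CL2 + CL2 * Ks + CL1 := by rw [hCP]; ring
  have hK1 : CS ≤ CP := by rw [hCPe]; linarith
  have hK2 : CS * ΛT ^ 2 * Real.exp (δ₁ * r₀) ≤ CP := by rw [hCPe, mul_assoc]; linarith
  have hK4 : CL2 ≤ CP := by rw [hCPe]; linarith
  have hK5 : CL2 * Ks ≤ CP := by rw [hCPe]; linarith
  have hK6 : CL1 ≤ CP := by rw [hCPe]; linarith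
  -- the supports of D*A₁, D*A₂
  have hfs₁ := divBη_support T U blk η hrefl hsym hL hge hr₀ hΛT hnb hnbl hA₁
  have hfs₂ := divBη_support T U blk η hrefl hsym hL hge hr₀ hΛT hnb hnbl hA₂
  have hfs₂' : ∀ x, divBη T U η A₂ x ≠ 0 → g.dist (blk x) y' ≤ r₀ := fun x hx => (hfs₂ x hx).1
  set f₁ : S → 𝔸 := divBη T U η A₁ with hf₁
  set f₂ : S → 𝔸 := divBη T U η A₂ with hf₂
  have hss := ssup_nonneg f₂
  have hsl := sl1_nonneg hη.le d f₁
  have hlen : ∀ z : g.Site, 0 < g.len z := len_pos hL hge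
  -- the rate δ_P = δ₁ − αδ₀ ≦ δ₁ on the sup side
  have hrate : ∀ a b : g.Site, Real.exp (-(δ₁ * g.dist a b)) ≤ Real.exp (-((δ₁ - α * δ₀) * g.dist a b)) :=
    fun a b => exp_rate_le (by linarith) (hd a b)
  refine ineq3131_assembled T U blk hU τ hη d (fun A => Gp (divBη T U η A - Pp (divBη T U η A))) A₁ A₂ y y' hd hsym htri
    hrow h260 hαδ hσ hL hge hRM (δP := δ₁ - α * δ₀) hρ hρP hA₁ hA₂ (bsup_nonneg A₂) (fun μ x => norm_le_bsup A₂ μ x)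
    hcJ hMa hJ hCP0 hss hsl ?_ ?_ ?_ ?_ ?_ ?_
  · -- hS0
    intro x
    have h := sup_entry0 blk Gp Pp hBG hδ₁ hG0 hη.le d hv hvol hKP hP hd hsym htri hrow hσ hδ₁σ hfs₂' x
    have hfac : 0 ≤ g.len (blk x) ^ 2 * Real.exp (-((δ₁ - α * δ₀) * g.dist (blk x) y')) * ssup f₂ :=
      mul_nonneg (mul_nonneg (pow_two_nonneg _) (Real.exp_nonneg _)) hss
    calc ‖Gp (f₂ - Pp f₂) x‖ ≤ CS * g.len (blk x) ^ 2 * Real.exp (-(δ₁ * g.dist (blk x) y')) * ssup f₂ := h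
      _ ≤ CS * g.len (blk x) ^ 2 * Real.exp (-((δ₁ - α * δ₀) * g.dist (blk x) y')) * ssup f₂ :=
          mul_le_mul_of_nonneg_right (mul_le_mul_of_nonneg_left (hrate _ _) (mul_nonneg hCS0 (pow_two_nonneg _))) hss
      _ = CS * (g.len (blk x) ^ 2 * Real.exp (-((δ₁ - α * δ₀) * g.dist (blk x) y')) * ssup f₂) := by ring
      _ ≤ CP * (g.len (blk x) ^ 2 * Real.exp (-((δ₁ - α * δ₀) * g.dist (blk x) y')) * ssup f₂) :=
          mul_le_mul_of_nonneg_right hK1 hfac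
      _ = CP * g.len (blk x) ^ 2 * Real.exp (-((δ₁ - α * δ₀) * g.dist (blk x) y')) * ssup f₂ := by ring
  · -- hS0s
    intro μ x
    have h := sup_entry0_shift T blk Gp Pp hBG hδ₁ hG0 hη.le d hv hvol hKP hP hd hsym htri hrow hσ hδ₁σ hL hge hnb hnbl
      hfs₂' μ x
    have hfac : 0 ≤ g.len (blk x) ^ 2 * Real.exp (-((δ₁ - α * δ₀) * g.dist (blk x) y')) * ssup f₂ :=
      mul_nonneg (mul_nonneg (pow_two_nonneg _) (Real.exp_nonneg _)) hss
    have hK20 : 0 ≤ CS * ΛT ^ 2 * Real.exp (δ₁ * r₀) := mul_nonneg (mul_nonneg hCS0 (pow_nonneg hΛT0 2)) (Real.exp_nonneg _)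
    calc ‖Gp (f₂ - Pp f₂) (T μ x)‖
        ≤ CS * ΛT ^ 2 * Real.exp (δ₁ * r₀) * g.len (blk x) ^ 2 * Real.exp (-(δ₁ * g.dist (blk x) y')) * ssup f₂ := h
      _ ≤ CS * ΛT ^ 2 * Real.exp (δ₁ * r₀) * g.len (blk x) ^ 2 * Real.exp (-((δ₁ - α * δ₀) * g.dist (blk x) y')) * ssup f₂ :=
          mul_le_mul_of_nonneg_right (mul_le_mul_of_nonneg_left (hrate _ _) (mul_nonneg hK20 (pow_two_nonneg _))) hss
      _ = (CS * ΛT ^ 2 * Real.exp (δ₁ * r₀)) * (g.len (blk x) ^ 2 * Real.exp (-((δ₁ - α * δ₀) * g.dist (blk x) y')) * ssup f₂) := by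
          ring
      _ ≤ CP * (g.len (blk x) ^ 2 * Real.exp (-((δ₁ - α * δ₀) * g.dist (blk x) y')) * ssup f₂) :=
          mul_le_mul_of_nonneg_right hK2 hfac
      _ = CP * g.len (blk x) ^ 2 * Real.exp (-((δ₁ - α * δ₀) * g.dist (blk x) y')) * ssup f₂ := by ring
  · -- hS1
    intro μ x
    have h := sup_entry1 T U blk Gp Pp hBG hδ₁ η hG1 hη.le d hv hvol hKP hP hd hsym htri hrow hσ hδ₁σ hL hge hfs₂' μ x
    have hfac : 0 ≤ g.len (blk x) * Real.exp (-((δ₁ - α * δ₀) * g.dist (blk x) y')) * ssup f₂ :=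
      mul_nonneg (mul_nonneg (hlen _).le (Real.exp_nonneg _)) hss
    calc ‖covDη T U η (Gp (f₂ - Pp f₂)) μ x‖ ≤ CS * g.len (blk x) * Real.exp (-(δ₁ * g.dist (blk x) y')) * ssup f₂ := h
      _ ≤ CS * g.len (blk x) * Real.exp (-((δ₁ - α * δ₀) * g.dist (blk x) y')) * ssup f₂ :=
          mul_le_mul_of_nonneg_right (mul_le_mul_of_nonneg_left (hrate _ _) (mul_nonneg hCS0 (hlen _).le)) hss
      _ = CS * (g.len (blk x) * Real.exp (-((δ₁ - α * δ₀) * g.dist (blk x) y')) * ssup f₂) := by ring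
      _ ≤ CP * (g.len (blk x) * Real.exp (-((δ₁ - α * δ₀) * g.dist (blk x) y')) * ssup f₂) :=
          mul_le_mul_of_nonneg_right hK1 hfac
      _ = CP * g.len (blk x) * Real.exp (-((δ₁ - α * δ₀) * g.dist (blk x) y')) * ssup f₂ := by ring
  · -- hL0
    intro y''
    have h := l1_entry0 blk Gp Pp hBG hδ₁ hη.le d hG0d hv hvol hKP hPt hd hsym htri hrow hσ h260 hαδ hαδ₁ hδL hL hge hRM
      hΛT0 hfs₁ y''
    have hfac : 0 ≤ g.len y ^ 2 * Real.exp (-((δ₁ - α * δ₀) * g.dist y y'')) * sl1 η d f₁ :=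
      mul_nonneg (mul_nonneg (pow_two_nonneg _) (Real.exp_nonneg _)) hsl
    calc sl1On blk η d y'' (Gp (f₁ - Pp f₁)) ≤ CL2 * g.len y ^ 2 * Real.exp (-((δ₁ - α * δ₀) * g.dist y y'')) * sl1 η d f₁ := h
      _ = CL2 * (g.len y ^ 2 * Real.exp (-((δ₁ - α * δ₀) * g.dist y y'')) * sl1 η d f₁) := by ring
      _ ≤ CP * (g.len y ^ 2 * Real.exp (-((δ₁ - α * δ₀) * g.dist y y'')) * sl1 η d f₁) :=
          mul_le_mul_of_nonneg_right hK4 hfac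
      _ = CP * g.len y ^ 2 * Real.exp (-((δ₁ - α * δ₀) * g.dist y y'')) * sl1 η d f₁ := by ring
  · -- hL0s
    intro y'' μ
    have h := l1_entry0_shift T blk Gp Pp hBG hδ₁ hη.le d hG0d hv hvol hKP hPt hd hsym htri hrow hσ h260 hαδ hαδ₁ hδL hL hge
      hRM hΛT0 hnb hfs₁ y'' μ
    have hfac : 0 ≤ g.len y ^ 2 * Real.exp (-((δ₁ - α * δ₀) * g.dist y y'')) * sl1 η d f₁ :=
      mul_nonneg (mul_nonneg (pow_two_nonneg _) (Real.exp_nonneg _)) hsl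
    calc sl1On blk η d y'' (Gp (f₁ - Pp f₁) ∘ (T μ))
        ≤ CL2 * Ks * g.len y ^ 2 * Real.exp (-((δ₁ - α * δ₀) * g.dist y y'')) * sl1 η d f₁ := by
          refine h.trans (le_of_eq ?_); rw [hKs]; ring
      _ = (CL2 * Ks) * (g.len y ^ 2 * Real.exp (-((δ₁ - α * δ₀) * g.dist y y'')) * sl1 η d f₁) := by ring
      _ ≤ CP * (g.len y ^ 2 * Real.exp (-((δ₁ - α * δ₀) * g.dist y y'')) * sl1 η d f₁) :=
          mul_le_mul_of_nonneg_right hK5 hfac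
      _ = CP * g.len y ^ 2 * Real.exp (-((δ₁ - α * δ₀) * g.dist y y'')) * sl1 η d f₁ := by ring
  · -- hL1
    intro y''
    have h := l1_entry1 T U blk Gp Pp hBG hδ₁ η hη.le d hG1d hv hvol hKP hPt hd hsym htri hrow hσ h260 hαδ hαδ₁ hδL hL hge
      hRM hΛT0 hfs₁ y''
    have hfac : 0 ≤ g.len y * Real.exp (-((δ₁ - α * δ₀) * g.dist y y'')) * sl1 η d f₁ :=
      mul_nonneg (mul_nonneg (hlen _).le (Real.exp_nonneg _)) hsl
    calc bl1On blk η d y'' (covDη T U η (Gp (f₁ - Pp f₁)))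
        ≤ BG * (ΛT * Real.exp (δ₀ * r₀) + g.L * c * KP * Real.exp (δ₁ * r₀)) * g.len y *
            Real.exp (-((δ₁ - α * δ₀) * g.dist y y'')) * sl1 η d f₁ := by simpa only [pow_one] using h
      _ = CL1 * (g.len y * Real.exp (-((δ₁ - α * δ₀) * g.dist y y'')) * sl1 η d f₁) := by rw [hCL1]; ring
      _ ≤ CP * (g.len y * Real.exp (-((δ₁ - α * δ₀) * g.dist y y'')) * sl1 η d f₁) :=
          mul_le_mul_of_nonneg_right hK6 hfac
      _ = CP * g.len y * Real.exp (-((δ₁ - α * δ₀) * g.dist y y'')) * sl1 η d f₁ := by ring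


open Classical in
/-- **(3.131) from Theorem 3.1 and (3.49) AT THE PRINTED RATE of (3.49)** (`δ₁ = ½δ₀`): the instance of `ineq3131_letters` with the (3.49)
letters at rate `½δ₀` as printed on p. 399; the inputs then hold at `δ_P = ½δ₀ − αδ₀` and (3.131) follows at every `ρ ≧ 0` with
`ρ + σ + 2αδ₀ ≦ ½δ₀` — the honest reading of print's `e^{−(1/2)δ₀d(y,y′)}` under its generic-constant convention for `δ₀` (re-defined as a
common best constant pp. 423–424; cell GAPS G-B9-r06-2), `[4]` Lemma 2.1 being available «for every 0 < α < 1» and (2.61) at every rate `σ = α′δ₀`.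
[cite: Balaban1985BackgroundPropagators, (3.131) p.422, (3.49) p.399, Thm 3.12 p.423–424; Balaban1984PropagatorsII, Lemma 2.1 (2.60)–(2.61) p.234] -/
theorem ineq3131_letters_printedRate
    (hU : ∀ μ x, ‖(U μ x : 𝔸)‖ ≤ 1 ∧ ‖(((U μ x)⁻¹ : 𝔸ˣ) : 𝔸)‖ ≤ 1) (τ : 𝔸 →L[ℂ] ℂ) {η : ℝ} (hη : 0 < η) (d : ℕ)
    (Gp Pp : (S → 𝔸) →+ (S → 𝔸)) (A₁ A₂ : ι → S → 𝔸) (y y' : g.Site)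
    (hd : ∀ a b : g.Site, 0 ≤ g.dist a b) (hrefl : ∀ a : g.Site, g.dist a a = 0) (hsym : DistSymm g) (htri : Triangle254 g)
    {σ c δ₀ α : ℝ} (hrow : RowSum g σ c) (h260 : Ineq260 g δ₀ α) (hαδ : 0 ≤ α * δ₀) (hσ : 0 ≤ σ)
    (hL : 1 ≤ g.L) (hge : 0 < g.eta) (hRM : 2 * Real.log g.L ≤ α * δ₀ * g.R * g.M)
    (hσδ : σ ≤ δ₀ / 2) (hαhalf : α * δ₀ ≤ δ₀ / 2)
    {r₀ ΛT : ℝ} (hr₀ : 0 ≤ r₀) (hΛT : 1 ≤ ΛT) (hnb : ∀ μ x, g.dist (blk x) (blk (T μ x)) ≤ r₀)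
    (hnbl : ∀ μ x, g.len (blk (T μ x)) ≤ ΛT * g.len (blk x))
    {v : g.Site → ℝ} (hv : ∀ y, 0 < v y) (hvol : ∀ y : g.Site, η ^ d * ∑ x : S, (if blk x = y then (1 : ℝ) else 0) ≤ v y)
    {BG : ℝ} (hBG : 0 ≤ BG)
    (hG0 : ∀ (y'' : g.Site) (f : S → 𝔸) (B : ℝ), 0 ≤ B → (∀ x, blk x = y'' → ‖f x‖ ≤ B) → (∀ x, blk x ≠ y'' → f x = 0) →
      ∀ x, ‖Gp f x‖ ≤ BG * g.len (blk x) ^ 2 * Real.exp (-(δ₀ * g.dist (blk x) y'')) * B)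
    (hG1 : ∀ (y'' : g.Site) (f : S → 𝔸) (B : ℝ), 0 ≤ B → (∀ x, blk x = y'' → ‖f x‖ ≤ B) → (∀ x, blk x ≠ y'' → f x = 0) →
      ∀ μ x, ‖covDη T U η (Gp f) μ x‖ ≤ BG * g.len (blk x) * Real.exp (-(δ₀ * g.dist (blk x) y'')) * B)
    (hG0d : ∀ (y y'' : g.Site) (f : S → 𝔸), (∀ x, blk x ≠ y → f x = 0) →
      sl1On blk η d y'' (Gp f) ≤ BG * g.len y ^ 2 * Real.exp (-(δ₀ * g.dist y y'')) * sl1 η d f)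
    (hG1d : ∀ (y y'' : g.Site) (f : S → 𝔸), (∀ x, blk x ≠ y → f x = 0) →
      bl1On blk η d y'' (covDη T U η (Gp f)) ≤ BG * g.len y * Real.exp (-(δ₀ * g.dist y y'')) * sl1 η d f)
    {KP : ℝ} (hKP : 0 ≤ KP)
    (hP : ∀ (f : S → 𝔸) (z : S), ‖Pp f z‖ ≤
      ∑ x' : S, η ^ d * (KP * Real.exp (-(δ₀ / 2 * g.dist (blk z) (blk x'))) * (v (blk x'))⁻¹) * ‖f x'‖)
    (hPt : ∀ (f : S → 𝔸) (z : S), ‖Pp f z‖ ≤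
      ∑ x' : S, η ^ d * (KP * Real.exp (-(δ₀ / 2 * g.dist (blk z) (blk x'))) * (v (blk z))⁻¹) * ‖f x'‖)
    (hA₁ : ∀ μ x, blk x ≠ y → A₁ μ x = 0) (hA₂ : ∀ μ x, blk x ≠ y' → A₂ μ x = 0)
    {cJ Ma : ℝ} (hcJ : 0 ≤ cJ) (hMa : 0 ≤ Ma)
    (hJ : ∀ μ x, ‖B9Eq39Adjoint.J T U η μ x‖ ≤ cJ * Ma * (g.len (blk x) ^ 3)⁻¹)
    {ρ : ℝ} (hρ : 0 ≤ ρ) (hρP : ρ + σ + 2 * (α * δ₀) ≤ δ₀ / 2) :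
    ‖B9Eq3131Pointwise.deltaPiPrimeBil T U η d (τ : 𝔸 →ₗ[ℂ] ℂ)
        (fun A => Gp (divBη T U η A - Pp (divBη T U η A))) A₁ A₂‖ ≤
      O1 ‖τ‖ cJ
        (c * Real.exp (σ * r₀) * (Real.exp (δ₀ * r₀) + c * KP * Real.exp (δ₀ / 2 * r₀)) * BG * (2 + ΛT ^ 2 * Real.exp (δ₀ / 2 * r₀))
          + BG * (ΛT ^ 2 * Real.exp (δ₀ * r₀) + g.L ^ 2 * c * KP * Real.exp (δ₀ / 2 * r₀)) *
              (1 + c * Real.exp (σ * r₀) * Real.exp ((δ₀ / 2 - α * δ₀) * r₀))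
          + BG * (ΛT * Real.exp (δ₀ * r₀) + g.L * c * KP * Real.exp (δ₀ / 2 * r₀)))
        (Fintype.card ι) g.L c * Ma * (sl1 η d (divBη T U η A₁) + (g.len y)⁻¹ * bl1 η d A₁)
        * Real.exp (-(ρ * g.dist y y')) * (ssup (divBη T U η A₂) + (g.len y')⁻¹ * bsup A₂) :=
  ineq3131_letters T U blk hU τ hη d Gp Pp A₁ A₂ y y' hd hrefl hsym htri hrow h260 hαδ hσ hL hge hRM (δ₁ := δ₀ / 2)
    (by linarith) hαhalf hr₀ hΛT hnb hnbl hv hvol hBG hG0 hG1 hG0d hG1d hKP hP hPt hA₁ hA₂ hcJ hMa hJ hρ (by linarith)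

end Assembly


/-! ## §8 (v1.1) The letters in the PRINTED KERNEL FORM of p. 393: the majorant / dual shapes of §7 from kernel-sum bounds -/

section KernelLetters

variable {𝔸 : Type*} [NormedRing 𝔸]
variable {S : Type*} [Fintype S]
variable {g : B6.Geometry} (blk : S → g.Site)

open Classical in
/-- **Kernel bound (column-volume reading) ⇒ block majorant** ((3.42) read for an operator given by a kernel — wording ours, not a print sentence —, `|T(x,x′)| ≦
K(y)e^{−δ₀d(y,y′)}(L^{j′}η)^{−d}` for `x ∈ Δ(y)`, `x′ ∈ Δ(y′)` — implies the majorant form `|(Tλ)(x)| ≦ K(y)e^{−δ₀d(y,y″)}|λ|` for `supp λ ⊂ Δ(y″)`, the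
block volume `η^d#Δ(y″) ≦ v(y″)` cancelling `v(y″)⁻¹`).  For an arbitrary map `Φ` on site functions.
[cite: Balaban1985BackgroundPropagators, p.393, (3.42) p.397; Balaban1984PropagatorsII, (2.64)–(2.66) p.234] -/
theorem majorant_of_kernel (Φ : (S → 𝔸) → S → 𝔸) {K : g.Site → ℝ} (hK : ∀ a, 0 ≤ K a) (δ₀ : ℝ) {η : ℝ} (hη : 0 ≤ η) (d : ℕ)
    {v : g.Site → ℝ} (hv : ∀ y, 0 < v y) (hvol : ∀ y : g.Site, η ^ d * ∑ x : S, (if blk x = y then (1 : ℝ) else 0) ≤ v y)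
    (hΦk : ∀ (f : S → 𝔸) (x : S), ‖Φ f x‖ ≤
      ∑ x' : S, η ^ d * (K (blk x) * Real.exp (-(δ₀ * g.dist (blk x) (blk x'))) * (v (blk x'))⁻¹) * ‖f x'‖) :
    ∀ (y'' : g.Site) (f : S → 𝔸) (B : ℝ), 0 ≤ B → (∀ x, blk x = y'' → ‖f x‖ ≤ B) → (∀ x, blk x ≠ y'' → f x = 0) →
      ∀ x, ‖Φ f x‖ ≤ K (blk x) * Real.exp (-(δ₀ * g.dist (blk x) y'')) * B := by
  intro y'' f B hB hfB hf0 x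
  have hηd : 0 ≤ η ^ d := pow_nonneg hη d
  set E : ℝ := Real.exp (-(δ₀ * g.dist (blk x) y'')) with hE
  have hcoef : 0 ≤ K (blk x) * E * (v y'')⁻¹ * B :=
    mul_nonneg (mul_nonneg (mul_nonneg (hK _) (Real.exp_nonneg _)) (inv_nonneg.mpr (hv _).le)) hB
  refine (hΦk f x).trans ?_
  calc ∑ x' : S, η ^ d * (K (blk x) * Real.exp (-(δ₀ * g.dist (blk x) (blk x'))) * (v (blk x'))⁻¹) * ‖f x'‖
      ≤ ∑ x' : S, (if blk x' = y'' then (1 : ℝ) else 0) * (η ^ d * (K (blk x) * E * (v y'')⁻¹ * B)) := by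
        refine Finset.sum_le_sum fun x' _ => ?_
        by_cases hx' : blk x' = y''
        · rw [if_pos hx', one_mul, hx']
          have h1 : η ^ d * (K (blk x) * E * (v y'')⁻¹) * ‖f x'‖ ≤ η ^ d * (K (blk x) * E * (v y'')⁻¹) * B :=
            mul_le_mul_of_nonneg_left (hfB x' hx')
              (mul_nonneg hηd (mul_nonneg (mul_nonneg (hK _) (Real.exp_nonneg _)) (inv_nonneg.mpr (hv _).le)))
          refine h1.trans (le_of_eq ?_); ring
        · rw [if_neg hx', zero_mul, hf0 x' hx', norm_zero, mul_zero]
    _ = (η ^ d * ∑ x' : S, (if blk x' = y'' then (1 : ℝ) else 0)) * (v y'')⁻¹ * (K (blk x) * E * B) := by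
        rw [← Finset.sum_mul]; ring
    _ ≤ v y'' * (v y'')⁻¹ * (K (blk x) * E * B) :=
        mul_le_mul_of_nonneg_right (mul_le_mul_of_nonneg_right (hvol y'') (inv_nonneg.mpr (hv _).le))
          (mul_nonneg (mul_nonneg (hK _) (Real.exp_nonneg _)) hB)
    _ = K (blk x) * E * B := by rw [mul_inv_cancel₀ (hv y'').ne', one_mul]

open Classical in
/-- **Kernel bound for bond-valued outputs (column-volume reading) ⇒ block majorant**, componentwise ((3.42)₂ `∇_UG′` as a kernel ⇒ its majorant
form). [cite: Balaban1985BackgroundPropagators, p.393, (3.42) p.397; Balaban1984PropagatorsII, (2.64)–(2.66) p.234] -/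
theorem bmajorant_of_kernel {ι : Type*} (Ψ : (S → 𝔸) → ι → S → 𝔸) {K : g.Site → ℝ} (hK : ∀ a, 0 ≤ K a) (δ₀ : ℝ) {η : ℝ}
    (hη : 0 ≤ η) (d : ℕ) {v : g.Site → ℝ} (hv : ∀ y, 0 < v y)
    (hvol : ∀ y : g.Site, η ^ d * ∑ x : S, (if blk x = y then (1 : ℝ) else 0) ≤ v y)
    (hΨk : ∀ (f : S → 𝔸) (μ : ι) (x : S), ‖Ψ f μ x‖ ≤
      ∑ x' : S, η ^ d * (K (blk x) * Real.exp (-(δ₀ * g.dist (blk x) (blk x'))) * (v (blk x'))⁻¹) * ‖f x'‖) :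
    ∀ (y'' : g.Site) (f : S → 𝔸) (B : ℝ), 0 ≤ B → (∀ x, blk x = y'' → ‖f x‖ ≤ B) → (∀ x, blk x ≠ y'' → f x = 0) →
      ∀ μ x, ‖Ψ f μ x‖ ≤ K (blk x) * Real.exp (-(δ₀ * g.dist (blk x) y'')) * B :=
  fun y'' f B hB hfB hf0 μ =>
    majorant_of_kernel blk (fun h => Ψ h μ) hK δ₀ hη d hv hvol (fun h x => hΨk h μ x) y'' f B hB hfB hf0

open Classical in
/-- **Kernel bound (ROW-volume reading = the printed bound for the adjoint kernel) ⇒ L¹ dual letter**: `|T(x,x′)| ≦ K(y′)e^{−δ₀d(y,y′)}(L^{j}η)^{−d}`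
for `x ∈ Δ(y)`, `x′ ∈ Δ(y′)` (= (3.42) for `T*`, i.e. (3.42) itself by the symmetry of `G′ = (Δ′_a)⁻¹`) implies `‖Tλ‖_{L¹(Δ(y″))} ≦ K(y)e^{−δ₀d(y,y″)}‖λ‖_{L¹}`
for `supp λ ⊂ Δ(y)` (`d` symmetric). [cite: Balaban1985BackgroundPropagators, p.393–394, (3.42) p.397; Balaban1984PropagatorsII, (2.64)–(2.66) p.234] -/
theorem dual_of_kernelT (Φ : (S → 𝔸) → S → 𝔸) {K : g.Site → ℝ} (hK : ∀ a, 0 ≤ K a) (δ₀ : ℝ) {η : ℝ} (hη : 0 ≤ η) (d : ℕ)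
    {v : g.Site → ℝ} (hv : ∀ y, 0 < v y) (hvol : ∀ y : g.Site, η ^ d * ∑ x : S, (if blk x = y then (1 : ℝ) else 0) ≤ v y)
    (hsym : DistSymm g)
    (hΦkt : ∀ (f : S → 𝔸) (x : S), ‖Φ f x‖ ≤
      ∑ x' : S, η ^ d * (K (blk x') * Real.exp (-(δ₀ * g.dist (blk x) (blk x'))) * (v (blk x))⁻¹) * ‖f x'‖) :
    ∀ (y y'' : g.Site) (f : S → 𝔸), (∀ x, blk x ≠ y → f x = 0) →
      sl1On blk η d y'' (Φ f) ≤ K y * Real.exp (-(δ₀ * g.dist y y'')) * sl1 η d f := by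
  intro y y'' f hf0
  have hηd : 0 ≤ η ^ d := pow_nonneg hη d
  set E : ℝ := Real.exp (-(δ₀ * g.dist y y'')) with hE
  have hsl := sl1_nonneg hη d f
  -- pointwise on Δ(y″)
  have hpt : ∀ x, blk x = y'' → ‖Φ f x‖ ≤ (v y'')⁻¹ * (K y * E) * sl1 η d f := by
    intro x hx
    refine (hΦkt f x).trans ?_
    rw [sl1, Finset.mul_sum, Finset.mul_sum]
    refine Finset.sum_le_sum fun x' _ => ?_
    by_cases hfx : f x' = 0
    · rw [hfx, norm_zero, mul_zero, mul_zero, mul_zero]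
    · have hx' : blk x' = y := by
        by_contra h
        exact hfx (hf0 x' h)
      rw [hx, hx', hsym y'' y]
      refine le_of_eq ?_
      ring
  rw [sl1On_def]
  calc η ^ d * ∑ x : S, (if blk x = y'' then ‖Φ f x‖ else 0)
      ≤ η ^ d * ∑ x : S, (if blk x = y'' then (v y'')⁻¹ * (K y * E) * sl1 η d f else 0) := by
        refine mul_le_mul_of_nonneg_left (Finset.sum_le_sum fun x _ => ?_) hηd
        split_ifs with hx
        · exact hpt x hx
        · exact le_rfl
    _ = η ^ d * ((∑ x : S, (if blk x = y'' then (1 : ℝ) else 0)) * ((v y'')⁻¹ * (K y * E) * sl1 η d f)) := by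
        congr 1
        rw [Finset.sum_mul]
        refine Finset.sum_congr rfl fun x _ => ?_
        split_ifs <;> ring
    _ = (η ^ d * ∑ x : S, (if blk x = y'' then (1 : ℝ) else 0)) * (v y'')⁻¹ * ((K y * E) * sl1 η d f) := by ring
    _ ≤ v y'' * (v y'')⁻¹ * ((K y * E) * sl1 η d f) :=
        mul_le_mul_of_nonneg_right (mul_le_mul_of_nonneg_right (hvol y'') (inv_nonneg.mpr (hv _).le))
          (mul_nonneg (mul_nonneg (hK _) (Real.exp_nonneg _)) hsl)
    _ = K y * E * sl1 η d f := by rw [mul_inv_cancel₀ (hv y'').ne', one_mul]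

open Classical in
/-- **Row-volume kernel bound for bond-valued outputs ⇒ bond L¹ dual letter**, with the factor `|ι|` (number of directions) from the sum over
the components: `‖Ψλ‖_{L¹(Δ(y″)), bonds} ≦ |ι|·K(y)e^{−δ₀d(y,y″)}‖λ‖_{L¹}` for `supp λ ⊂ Δ(y)` ((3.42)₃ `G′∇*_U` transposed = the kernel of `∇_UG′`).
[cite: Balaban1985BackgroundPropagators, p.393–394, (3.42) p.397; Balaban1984PropagatorsII, (2.64)–(2.66) p.234] -/
theorem bdual_of_kernelT {ι : Type*} [Fintype ι] (Ψ : (S → 𝔸) → ι → S → 𝔸) {K : g.Site → ℝ} (hK : ∀ a, 0 ≤ K a) (δ₀ : ℝ)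
    {η : ℝ} (hη : 0 ≤ η) (d : ℕ) {v : g.Site → ℝ} (hv : ∀ y, 0 < v y)
    (hvol : ∀ y : g.Site, η ^ d * ∑ x : S, (if blk x = y then (1 : ℝ) else 0) ≤ v y) (hsym : DistSymm g)
    (hΨkt : ∀ (f : S → 𝔸) (μ : ι) (x : S), ‖Ψ f μ x‖ ≤
      ∑ x' : S, η ^ d * (K (blk x') * Real.exp (-(δ₀ * g.dist (blk x) (blk x'))) * (v (blk x))⁻¹) * ‖f x'‖) :
    ∀ (y y'' : g.Site) (f : S → 𝔸), (∀ x, blk x ≠ y → f x = 0) →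
      bl1On blk η d y'' (Ψ f) ≤ (Fintype.card ι : ℝ) * K y * Real.exp (-(δ₀ * g.dist y y'')) * sl1 η d f := by
  intro y y'' f hf0
  have hηd : 0 ≤ η ^ d := pow_nonneg hη d
  have hcomp : ∀ μ : ι, sl1On blk η d y'' (fun x => Ψ f μ x) ≤ K y * Real.exp (-(δ₀ * g.dist y y'')) * sl1 η d f := fun μ =>
    dual_of_kernelT blk (fun h x => Ψ h μ x) hK δ₀ hη d hv hvol hsym (fun h x => hΨkt h μ x) y y'' f hf0
  have hsplit : bl1On blk η d y'' (Ψ f) = ∑ μ : ι, sl1On blk η d y'' (fun x => Ψ f μ x) := by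
    rw [bl1On_def]
    simp only [sl1On_def]
    rw [← Finset.mul_sum, Finset.sum_comm]
    congr 1
    refine Finset.sum_congr rfl fun x _ => ?_
    split_ifs
    · rfl
    · simp
  rw [hsplit]
  calc ∑ μ : ι, sl1On blk η d y'' (fun x => Ψ f μ x)
      ≤ ∑ _μ : ι, K y * Real.exp (-(δ₀ * g.dist y y'')) * sl1 η d f := Finset.sum_le_sum fun μ _ => hcomp μ
    _ = (Fintype.card ι : ℝ) * K y * Real.exp (-(δ₀ * g.dist y y'')) * sl1 η d f := by
        rw [Finset.sum_const, Finset.card_univ, nsmul_eq_mul]; ring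

end KernelLetters


section KernelAssembly

variable {𝔸 : Type*} [NormedRing 𝔸] [NormedAlgebra ℂ 𝔸]
variable {S : Type*} [Fintype S] {ι : Type*} [Fintype ι] [LinearOrder ι]
variable (T : ι → Equiv.Perm S) (U : ι → S → 𝔸ˣ)
variable {g : B6.Geometry} (blk : S → g.Site)

open Classical in
/-- **(3.131) FROM THEOREM 3.1 AND (3.49) WITH ALL LETTERS IN THE PRINTED KERNEL FORM** (p. 393 «⟨λ, λ′⟩ = Σ_x η^d tr λ(x)λ′(x)»; (3.42) p. 397
and (3.49) p. 399 read as kernel bounds `|T(x,x′)| ≦ K(Lʲη)^p(L^{j′}η)^{−d}e^{−δd(y,y′)}`): Theorem 3.1 (3.42)₁,₂ for `G′(U)`, `∇_UG′(U)` as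
kernel-sum bounds in the printed (column-volume) reading (`hGk`, `hG1k`) AND in the row-volume reading (`hGkt`, `hG1kt` = the printed bounds
(3.42)₁,₃ for the adjoint kernels, i.e. (3.42) itself by the symmetry of `G′ = (Δ′_a)⁻¹`, `(∇_UG′)* = G′∇*_U`), (3.49)₁ likewise (`hP`, `hPt`);
the majorant/dual letters of `ineq3131_letters` are then DERIVED (§8: `majorant_of_kernel`, `bmajorant_of_kernel`, `dual_of_kernelT`,
`bdual_of_kernelT`) and (3.131) follows with `B_G` replaced by `B_G(1 + |ι|)` (the bond L¹ entry sums the `|ι|` components).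
[cite: Balaban1985BackgroundPropagators, (3.131) p.422, p.393, (3.42) p.397, (3.49) p.399, (3.8) p.392; Balaban1984PropagatorsII, (2.64)–(2.66) p.234, Lemma 2.1 (2.60)–(2.61) p.234] -/
theorem ineq3131_kernelLetters
    (hU : ∀ μ x, ‖(U μ x : 𝔸)‖ ≤ 1 ∧ ‖(((U μ x)⁻¹ : 𝔸ˣ) : 𝔸)‖ ≤ 1) (τ : 𝔸 →L[ℂ] ℂ) {η : ℝ} (hη : 0 < η) (d : ℕ)
    (Gp Pp : (S → 𝔸) →+ (S → 𝔸)) (A₁ A₂ : ι → S → 𝔸) (y y' : g.Site)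
    (hd : ∀ a b : g.Site, 0 ≤ g.dist a b) (hrefl : ∀ a : g.Site, g.dist a a = 0) (hsym : DistSymm g) (htri : Triangle254 g)
    {σ c δ₀ α δ₁ : ℝ} (hrow : RowSum g σ c) (h260 : Ineq260 g δ₀ α) (hαδ : 0 ≤ α * δ₀) (hσ : 0 ≤ σ)
    (hL : 1 ≤ g.L) (hge : 0 < g.eta) (hRM : 2 * Real.log g.L ≤ α * δ₀ * g.R * g.M)
    (hδ₁σ : δ₁ + σ ≤ δ₀) (hαδ₁ : α * δ₀ ≤ δ₁)
    {r₀ ΛT : ℝ} (hr₀ : 0 ≤ r₀) (hΛT : 1 ≤ ΛT) (hnb : ∀ μ x, g.dist (blk x) (blk (T μ x)) ≤ r₀)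
    (hnbl : ∀ μ x, g.len (blk (T μ x)) ≤ ΛT * g.len (blk x))
    {v : g.Site → ℝ} (hv : ∀ y, 0 < v y) (hvol : ∀ y : g.Site, η ^ d * ∑ x : S, (if blk x = y then (1 : ℝ) else 0) ≤ v y)
    -- THEOREM 3.1 for G′(U) in the printed kernel form: (3.42)₁,₂ (column volume) and (3.42)₁,₃ transposed (row volume)
    {BG : ℝ} (hBG : 0 ≤ BG)
    (hGk : ∀ (f : S → 𝔸) (x : S), ‖Gp f x‖ ≤
      ∑ x' : S, η ^ d * (BG * g.len (blk x) ^ 2 * Real.exp (-(δ₀ * g.dist (blk x) (blk x'))) * (v (blk x'))⁻¹) * ‖f x'‖)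
    (hGkt : ∀ (f : S → 𝔸) (x : S), ‖Gp f x‖ ≤
      ∑ x' : S, η ^ d * (BG * g.len (blk x') ^ 2 * Real.exp (-(δ₀ * g.dist (blk x) (blk x'))) * (v (blk x))⁻¹) * ‖f x'‖)
    (hG1k : ∀ (f : S → 𝔸) (μ : ι) (x : S), ‖covDη T U η (Gp f) μ x‖ ≤
      ∑ x' : S, η ^ d * (BG * g.len (blk x) * Real.exp (-(δ₀ * g.dist (blk x) (blk x'))) * (v (blk x'))⁻¹) * ‖f x'‖)
    (hG1kt : ∀ (f : S → 𝔸) (μ : ι) (x : S), ‖covDη T U η (Gp f) μ x‖ ≤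
      ∑ x' : S, η ^ d * (BG * g.len (blk x') * Real.exp (-(δ₀ * g.dist (blk x) (blk x'))) * (v (blk x))⁻¹) * ‖f x'‖)
    -- (3.49)₁ for P(U) in the printed kernel form, both volume readings
    {KP : ℝ} (hKP : 0 ≤ KP)
    (hP : ∀ (f : S → 𝔸) (z : S), ‖Pp f z‖ ≤
      ∑ x' : S, η ^ d * (KP * Real.exp (-(δ₁ * g.dist (blk z) (blk x'))) * (v (blk x'))⁻¹) * ‖f x'‖)
    (hPt : ∀ (f : S → 𝔸) (z : S), ‖Pp f z‖ ≤
      ∑ x' : S, η ^ d * (KP * Real.exp (-(δ₁ * g.dist (blk z) (blk x'))) * (v (blk z))⁻¹) * ‖f x'‖)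
    (hA₁ : ∀ μ x, blk x ≠ y → A₁ μ x = 0) (hA₂ : ∀ μ x, blk x ≠ y' → A₂ μ x = 0)
    {cJ Ma : ℝ} (hcJ : 0 ≤ cJ) (hMa : 0 ≤ Ma)
    (hJ : ∀ μ x, ‖B9Eq39Adjoint.J T U η μ x‖ ≤ cJ * Ma * (g.len (blk x) ^ 3)⁻¹)
    {ρ : ℝ} (hρ : 0 ≤ ρ) (hρP : ρ + σ + α * δ₀ ≤ δ₁ - α * δ₀) :
    ‖B9Eq3131Pointwise.deltaPiPrimeBil T U η d (τ : 𝔸 →ₗ[ℂ] ℂ)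
        (fun A => Gp (divBη T U η A - Pp (divBη T U η A))) A₁ A₂‖ ≤
      O1 ‖τ‖ cJ
        (c * Real.exp (σ * r₀) * (Real.exp (δ₀ * r₀) + c * KP * Real.exp (δ₁ * r₀)) * (BG * (1 + (Fintype.card ι : ℝ))) *
            (2 + ΛT ^ 2 * Real.exp (δ₁ * r₀))
          + (BG * (1 + (Fintype.card ι : ℝ))) * (ΛT ^ 2 * Real.exp (δ₀ * r₀) + g.L ^ 2 * c * KP * Real.exp (δ₁ * r₀)) *
              (1 + c * Real.exp (σ * r₀) * Real.exp ((δ₁ - α * δ₀) * r₀))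
          + (BG * (1 + (Fintype.card ι : ℝ))) * (ΛT * Real.exp (δ₀ * r₀) + g.L * c * KP * Real.exp (δ₁ * r₀)))
        (Fintype.card ι) g.L c * Ma * (sl1 η d (divBη T U η A₁) + (g.len y)⁻¹ * bl1 η d A₁)
        * Real.exp (-(ρ * g.dist y y')) * (ssup (divBη T U η A₂) + (g.len y')⁻¹ * bsup A₂) := by
  set BG' : ℝ := BG * (1 + (Fintype.card ι : ℝ)) with hBG'
  have hnι : (0 : ℝ) ≤ Fintype.card ι := Nat.cast_nonneg _
  have hBG'0 : 0 ≤ BG' := mul_nonneg hBG (by linarith)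
  have hBGle : BG ≤ BG' := by rw [hBG']; nlinarith
  have hBGι : (Fintype.card ι : ℝ) * BG ≤ BG' := by rw [hBG']; nlinarith
  have hlen : ∀ z : g.Site, 0 ≤ g.len z := fun z => (len_pos hL hge z).le
  -- the majorant / dual letters of §7 from the kernel bounds (§8), then the constant B_G ↦ B_G(1 + |ι|)
  have hG0 : ∀ (y'' : g.Site) (f : S → 𝔸) (B : ℝ), 0 ≤ B → (∀ x, blk x = y'' → ‖f x‖ ≤ B) → (∀ x, blk x ≠ y'' → f x = 0) →
      ∀ x, ‖Gp f x‖ ≤ BG' * g.len (blk x) ^ 2 * Real.exp (-(δ₀ * g.dist (blk x) y'')) * B := by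
    intro y'' f B hB h1 h2 x
    have h := majorant_of_kernel blk Gp (K := fun a => BG * g.len a ^ 2) (fun a => mul_nonneg hBG (pow_two_nonneg _)) δ₀ hη.le d
      hv hvol hGk y'' f B hB h1 h2 x
    refine h.trans ?_
    exact mul_le_mul_of_nonneg_right (mul_le_mul_of_nonneg_right (mul_le_mul_of_nonneg_right hBGle (pow_two_nonneg _))
      (Real.exp_nonneg _)) hB
  have hG1 : ∀ (y'' : g.Site) (f : S → 𝔸) (B : ℝ), 0 ≤ B → (∀ x, blk x = y'' → ‖f x‖ ≤ B) → (∀ x, blk x ≠ y'' → f x = 0) →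
      ∀ μ x, ‖covDη T U η (Gp f) μ x‖ ≤ BG' * g.len (blk x) * Real.exp (-(δ₀ * g.dist (blk x) y'')) * B := by
    intro y'' f B hB h1 h2 μ x
    have h := bmajorant_of_kernel blk (fun h => covDη T U η (Gp h)) (K := fun a => BG * g.len a)
      (fun a => mul_nonneg hBG (hlen a)) δ₀ hη.le d hv hvol hG1k y'' f B hB h1 h2 μ x
    refine h.trans ?_
    exact mul_le_mul_of_nonneg_right (mul_le_mul_of_nonneg_right (mul_le_mul_of_nonneg_right hBGle (hlen _))
      (Real.exp_nonneg _)) hB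
  have hG0d : ∀ (y y'' : g.Site) (f : S → 𝔸), (∀ x, blk x ≠ y → f x = 0) →
      sl1On blk η d y'' (Gp f) ≤ BG' * g.len y ^ 2 * Real.exp (-(δ₀ * g.dist y y'')) * sl1 η d f := by
    intro y₀ y'' f h0
    have h := dual_of_kernelT blk Gp (K := fun a => BG * g.len a ^ 2) (fun a => mul_nonneg hBG (pow_two_nonneg _)) δ₀ hη.le d
      hv hvol hsym hGkt y₀ y'' f h0
    refine h.trans ?_
    exact mul_le_mul_of_nonneg_right (mul_le_mul_of_nonneg_right (mul_le_mul_of_nonneg_right hBGle (pow_two_nonneg _))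
      (Real.exp_nonneg _)) (sl1_nonneg hη.le d f)
  have hG1d : ∀ (y y'' : g.Site) (f : S → 𝔸), (∀ x, blk x ≠ y → f x = 0) →
      bl1On blk η d y'' (covDη T U η (Gp f)) ≤ BG' * g.len y * Real.exp (-(δ₀ * g.dist y y'')) * sl1 η d f := by
    intro y₀ y'' f h0
    have h := bdual_of_kernelT blk (fun h => covDη T U η (Gp h)) (K := fun a => BG * g.len a)
      (fun a => mul_nonneg hBG (hlen a)) δ₀ hη.le d hv hvol hsym hG1kt y₀ y'' f h0
    refine h.trans ?_
    have : (Fintype.card ι : ℝ) * (BG * g.len y₀) ≤ BG' * g.len y₀ := by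
      rw [← mul_assoc]; exact mul_le_mul_of_nonneg_right hBGι (hlen _)
    exact mul_le_mul_of_nonneg_right (mul_le_mul_of_nonneg_right this (Real.exp_nonneg _)) (sl1_nonneg hη.le d f)
  exact ineq3131_letters T U blk hU τ hη d Gp Pp A₁ A₂ y y' hd hrefl hsym htri hrow h260 hαδ hσ hL hge hRM hδ₁σ hαδ₁ hr₀ hΛT hnb hnbl
    hv hvol hBG'0 hG0 hG1 hG0d hG1d hKP hP hPt hA₁ hA₂ hcJ hMa hJ hρ hρP

end KernelAssembly

end Literature.MathematicalPhysics.QuantumFieldTheory.Balaban1983to89.B9Ineq3131Letters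

end
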